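import Literature.NumberTheory.Sieve.BombieriFriedlanderIwaniecTheorem7StarSwitchPiece
import HarnessLib

/-!
# Bombieri–Friedlander–Iwaniec 1986, Theorem 7* (§14): the `q ↔ s` switch, analytic evaluation

Topic `Literature/NumberTheory/Sieve`; continuation of `…Theorem7StarSwitchPiece`.  Everything here is
PROVED; no named fact is introduced.

This file evaluates the three non-corner terms of `BFI.deltaStarSets_piece_le` — the model error
(`sum_merrTerm_le`), the ambiguous `A`-part `∑ ρ_J(K̃)` (`sum_rhoJ_Splus_le`: Cauchy–Schwarz,
multiplicities `valMult_Ktil_le`, second moment via `sum_rhoJ_sq_le_explicit` and Shiu's theorem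
on the two short windows `Jfix = (A₁, B₁] ∪ (A₂, B₂]`) and the ambiguous `B`-part (`Bsum_le`: the
two `s'`-windows of a cell, `windows_le`, have logarithmic length `2 log(c₂/c₁) + O(D₊/K₋)`) — by
elementary divisor-sum estimates (`Literature.NumberTheory.Sieve.exists_sum_sigma_zero_pow_le`
and its relatives) and Shiu's theorem on short intervals (`…SwitchAmbiguous`).

## References

* E. Bombieri, J. B. Friedlander, H. Iwaniec, *Primes in arithmetic progressions to large moduli*,
  Acta Math. 156 (1986), 203–251: §13 p. 241–242, §14 p. 246. [BombieriFriedlanderIwaniecActa1986]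
-/

noncomputable section

open Finset Real

open scoped ArithmeticFunction.sigma ArithmeticFunction.Moebius

namespace Literature.NumberTheory.Sieve

namespace BFI

/-! ### Divisor sums with a uniform logarithm -/

/-- `∑_{n ≤ X} τ(n) ≤ C (X + 2) (log Y)^4` and `∑_{n ≤ X} τ(n)/n ≤ C (log Y)^4` for `X ≤ Y`, `Y ≥ 2`,
with one constant. [folklore] -/
theorem exists_divisor_sums_le :
    ∃ C : ℝ, 1 ≤ C ∧ ∀ X Y : ℕ, X ≤ Y → 2 ≤ Y →
      (∑ n ∈ Icc 1 X, (σ 0 n : ℝ)) ≤ C * ((X : ℝ) + 2) * Real.log Y ^ 4 ∧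
      (∑ n ∈ Icc 1 X, (σ 0 n : ℝ) / n) ≤ C * Real.log Y ^ 4 ∧
      (∑ n ∈ Icc 1 X, (σ 0 n : ℝ) ^ 2) ≤ C * ((X : ℝ) + 2) * Real.log Y ^ 8 ∧
      (∑ n ∈ Icc 1 X, (σ 0 n : ℝ) ^ 2 / n) ≤ C * Real.log Y ^ 8 := by
  obtain ⟨C₁, hC₁, h₁⟩ := exists_sum_sigma_zero_pow_le 1
  obtain ⟨C₂, hC₂, h₂⟩ := exists_sum_sigma_zero_pow_div_le 1
  obtain ⟨C₃, hC₃, h₃⟩ := exists_sum_sigma_zero_pow_le 2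
  obtain ⟨C₄, hC₄, h₄⟩ := exists_sum_sigma_zero_pow_div_le 2
  refine ⟨max (max C₁ C₂) (max (max C₃ C₄) 1), le_max_of_le_right (le_max_right _ _), fun X Y hXY hY => ?_⟩
  set C := max (max C₁ C₂) (max (max C₃ C₄) 1) with hC
  have hC1 : C₁ ≤ C := le_max_of_le_left (le_max_left _ _)
  have hC2 : C₂ ≤ C := le_max_of_le_left (le_max_right _ _)
  have hC3 : C₃ ≤ C := le_max_of_le_right (le_max_of_le_left (le_max_left _ _))
  have hC4 : C₄ ≤ C := le_max_of_le_right (le_max_of_le_left (le_max_right _ _))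
  set X' := max X 2 with hX'
  have hX'2 : 2 ≤ X' := le_max_right _ _
  have hX'Y : X' ≤ Y := max_le hXY hY
  have hsub : Icc 1 X ⊆ Icc 1 X' := by
    intro n hn; rw [Finset.mem_Icc] at hn ⊢; exact ⟨hn.1, hn.2.trans (le_max_left _ _)⟩
  have hlogX' : Real.log X' ≤ Real.log Y :=
    Real.log_le_log (by exact_mod_cast (by omega : 0 < X')) (by exact_mod_cast hX'Y)
  have hlog0 : 0 ≤ Real.log X' := Real.log_nonneg (by exact_mod_cast (by omega : 1 ≤ X'))
  have hX'le : (X' : ℝ) ≤ (X : ℝ) + 2 := by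
    rw [hX']; rcases le_or_gt X 2 with h | h
    · rw [max_eq_right h]; push_cast; have : (0:ℝ) ≤ X := Nat.cast_nonneg X; linarith
    · rw [max_eq_left h.le]; linarith
  have hpow4 : Real.log X' ^ 4 ≤ Real.log Y ^ 4 := pow_le_pow_left₀ hlog0 hlogX' 4
  have hpow8 : Real.log X' ^ 8 ≤ Real.log Y ^ 8 := pow_le_pow_left₀ hlog0 hlogX' 8
  refine ⟨?_, ?_, ?_, ?_⟩
  · calc ∑ n ∈ Icc 1 X, (σ 0 n : ℝ) ≤ ∑ n ∈ Icc 1 X', (σ 0 n : ℝ) ^ 1 := by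
          simp only [pow_one]; exact Finset.sum_le_sum_of_subset_of_nonneg hsub fun _ _ _ => by positivity
      _ ≤ C₁ * X' * Real.log X' ^ (2 ^ (1 + 1)) := h₁ X' hX'2
      _ ≤ C * ((X : ℝ) + 2) * Real.log Y ^ 4 := by
          norm_num
          have : (0 : ℝ) ≤ X' := by positivity
          calc C₁ * X' * Real.log X' ^ 4 ≤ C * ((X : ℝ) + 2) * Real.log X' ^ 4 := by
                apply mul_le_mul_of_nonneg_right _ (by positivity)
                exact mul_le_mul hC1 hX'le this (by linarith [hC₁.le])
            _ ≤ C * ((X : ℝ) + 2) * Real.log Y ^ 4 := by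
                apply mul_le_mul_of_nonneg_left hpow4; positivity
  · calc ∑ n ∈ Icc 1 X, (σ 0 n : ℝ) / n ≤ ∑ n ∈ Icc 1 X', (σ 0 n : ℝ) ^ 1 / n := by
          simp only [pow_one]; exact Finset.sum_le_sum_of_subset_of_nonneg hsub fun _ _ _ => by positivity
      _ ≤ C₂ * Real.log X' ^ (2 ^ (1 + 1)) := h₂ X' hX'2
      _ ≤ C * Real.log Y ^ 4 := by
          norm_num
          exact mul_le_mul hC2 hpow4 (by positivity) (by linarith [hC₂.le])
  · calc ∑ n ∈ Icc 1 X, (σ 0 n : ℝ) ^ 2 ≤ ∑ n ∈ Icc 1 X', (σ 0 n : ℝ) ^ 2 :=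
          Finset.sum_le_sum_of_subset_of_nonneg hsub fun _ _ _ => by positivity
      _ ≤ C₃ * X' * Real.log X' ^ (2 ^ (2 + 1)) := h₃ X' hX'2
      _ ≤ C * ((X : ℝ) + 2) * Real.log Y ^ 8 := by
          norm_num
          have : (0 : ℝ) ≤ X' := by positivity
          calc C₃ * X' * Real.log X' ^ 8 ≤ C * ((X : ℝ) + 2) * Real.log X' ^ 8 := by
                apply mul_le_mul_of_nonneg_right _ (by positivity)
                exact mul_le_mul hC3 hX'le this (by linarith [hC₃.le])
            _ ≤ C * ((X : ℝ) + 2) * Real.log Y ^ 8 := by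
                apply mul_le_mul_of_nonneg_left hpow8; positivity
  · calc ∑ n ∈ Icc 1 X, (σ 0 n : ℝ) ^ 2 / n ≤ ∑ n ∈ Icc 1 X', (σ 0 n : ℝ) ^ 2 / n :=
          Finset.sum_le_sum_of_subset_of_nonneg hsub fun _ _ _ => by positivity
      _ ≤ C₄ * Real.log X' ^ (2 ^ (2 + 1)) := h₄ X' hX'2
      _ ≤ C * Real.log Y ^ 8 := by
          norm_num
          exact mul_le_mul hC4 hpow8 (by positivity) (by linarith [hC₄.le])

/-- `r/φ(r) ≤ τ(r)` and `1/φ(r) ≤ τ(r)/r` (`r ≥ 1`). [folklore] -/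
theorem div_totient_le_sigma (r : ℕ) (hr : 0 < r) :
    (r : ℝ) / Nat.totient r ≤ σ 0 r ∧ (1 : ℝ) / Nat.totient r ≤ (σ 0 r : ℝ) / r := by
  have h := inv_totient_le_sigma_zero_div r
  have hr' : (0 : ℝ) < r := by exact_mod_cast hr
  constructor
  · calc (r : ℝ) / Nat.totient r = r * ((Nat.totient r : ℝ))⁻¹ := by rw [div_eq_mul_inv]
      _ ≤ r * ((σ 0 r : ℝ) / r) := mul_le_mul_of_nonneg_left h hr'.le
      _ = σ 0 r := by field_simp
  · rw [one_div]; exact h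

/-! ### The model error of a switched piece -/

set_option maxHeartbeats 800000 in
/-- **The model error summed over a switched piece**: with `2|a| ≤ lmn` on the piece and all ranges
`≤ Y` (`Y ≥ 2`),
`∑_{r,l,m,n} merrTerm ≤ merrConst · Φ(S+2Q') · τ(|a|) · C⁴ (log Y)^{16} · (2Q'(R+2) + (L+2)(M'+2)(N'+2)/Q')`.
[cite: BombieriFriedlanderIwaniecActa1986, §13 p. 241–242] -/
theorem sum_merrTerm_le {C : ℝ} (hC1 : 1 ≤ C)
    (hC : ∀ X Y : ℕ, X ≤ Y → 2 ≤ Y →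
      (∑ n ∈ Icc 1 X, (σ 0 n : ℝ)) ≤ C * ((X : ℝ) + 2) * Real.log Y ^ 4 ∧
      (∑ n ∈ Icc 1 X, (σ 0 n : ℝ) / n) ≤ C * Real.log Y ^ 4 ∧
      (∑ n ∈ Icc 1 X, (σ 0 n : ℝ) ^ 2) ≤ C * ((X : ℝ) + 2) * Real.log Y ^ 8 ∧
      (∑ n ∈ Icc 1 X, (σ 0 n : ℝ) ^ 2 / n) ≤ C * Real.log Y ^ 8)
    (a : ℤ) (ha : a ≠ 0) (S Q' rlo R L mlo M' nlo N' Y : ℕ) (hQ' : 0 < Q') (hY : 2 ≤ Y)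
    (hL : L ≤ Y) (hM : M' ≤ Y) (hN : N' ≤ Y) (hR : R ≤ Y)
    (hpiece : ∀ l : ℕ, 1 ≤ l → ∀ m ∈ Ioc mlo M', ∀ n ∈ Ioc nlo N', 2 * (a.natAbs : ℤ) ≤ ((l * m * n : ℕ) : ℤ)) :
    ∑ r ∈ Ioc rlo R, ∑ l ∈ Icc 1 L, ∑ m ∈ Ioc mlo M', ∑ n ∈ Ioc nlo N', merrTerm a S Q' r l m n ≤
      merrConst a S * totInvSum (S + 2 * Q') * (σ 0 a.natAbs : ℝ) * C ^ 4 * Real.log Y ^ 16 *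
        (2 * Q' * ((R : ℝ) + 2) + ((L : ℝ) + 2) * ((M' : ℝ) + 2) * ((N' : ℝ) + 2) / Q') := by
  have hmc := merrConst_nonneg a S
  have hΦ := totInvSum_nonneg (S + 2 * Q')
  have hQ0 : (0 : ℝ) < Q' := by exact_mod_cast hQ'
  have hlogY : 0 ≤ Real.log Y := Real.log_nonneg (by exact_mod_cast (by omega : 1 ≤ Y))
  set K₀ := merrConst a S * totInvSum (S + 2 * Q') * (σ 0 a.natAbs : ℝ) with hK₀
  have hK₀0 : 0 ≤ K₀ := by rw [hK₀]; positivity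
  -- the four one-variable sums
  set Ar := ∑ r ∈ Ioc rlo R, (r : ℝ) / Nat.totient r with hAr
  set Br := ∑ r ∈ Ioc rlo R, (1 : ℝ) / Nat.totient r with hBr
  set Dl := ∑ l ∈ Icc 1 L, (σ 0 l : ℝ) / l with hDl
  set El := ∑ l ∈ Icc 1 L, (σ 0 l : ℝ) with hEl
  set Dm := ∑ m ∈ Ioc mlo M', (σ 0 m : ℝ) / m with hDm
  set Em := ∑ m ∈ Ioc mlo M', (σ 0 m : ℝ) with hEm
  set Dn := ∑ n ∈ Ioc nlo N', (σ 0 n : ℝ) / n with hDn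
  set En := ∑ n ∈ Ioc nlo N', (σ 0 n : ℝ) with hEn
  have h0Ar : 0 ≤ Ar := Finset.sum_nonneg fun _ _ => by positivity
  have h0Br : 0 ≤ Br := Finset.sum_nonneg fun _ _ => by positivity
  have h0Dl : 0 ≤ Dl := Finset.sum_nonneg fun _ _ => by positivity
  have h0El : 0 ≤ El := Finset.sum_nonneg fun _ _ => by positivity
  have h0Dm : 0 ≤ Dm := Finset.sum_nonneg fun _ _ => by positivity
  have h0Em : 0 ≤ Em := Finset.sum_nonneg fun _ _ => by positivity
  have h0Dn : 0 ≤ Dn := Finset.sum_nonneg fun _ _ => by positivity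
  have h0En : 0 ≤ En := Finset.sum_nonneg fun _ _ => by positivity
  -- Step 1: each term, in separated form
  have hterm : ∀ r ∈ Ioc rlo R, ∀ l ∈ Icc 1 L, ∀ m ∈ Ioc mlo M', ∀ n ∈ Ioc nlo N',
      merrTerm a S Q' r l m n ≤
        (K₀ * (2 * Q') * ((r : ℝ) / Nat.totient r) * ((σ 0 l : ℝ) / l) * ((σ 0 m : ℝ) / m)) * ((σ 0 n : ℝ) / n) +
          (K₀ * (1 / Q') * ((1 : ℝ) / Nat.totient r) * (σ 0 l : ℝ) * (σ 0 m : ℝ)) * (σ 0 n : ℝ) := by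
    intro r hr l hl m hm n hn
    have hr0 : 0 < r := by rw [Finset.mem_Ioc] at hr; omega
    have hl1 : 1 ≤ l := (Finset.mem_Icc.1 hl).1
    have hm0 : 0 < m := by rw [Finset.mem_Ioc] at hm; omega
    have hn0 : 0 < n := by rw [Finset.mem_Ioc] at hn; omega
    have h2a := hpiece l hl1 m hm n hn
    have hl0' : (0 : ℝ) < l := by exact_mod_cast hl1
    have hm0' : (0 : ℝ) < m := by exact_mod_cast hm0
    have hn0' : (0 : ℝ) < n := by exact_mod_cast hn0
    have hlmn0 : (0 : ℝ) < (l : ℝ) * m * n := by positivity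
    have hφr : (0 : ℝ) < Nat.totient r := by exact_mod_cast Nat.totient_pos.2 hr0
    -- `lmn − a ≥ lmn/2`
    have hden : ((l : ℝ) * m * n) / 2 ≤ (((l * m * n : ℕ) : ℝ) - a) := by
      have h1 : (2 * (a.natAbs : ℤ) : ℝ) ≤ (((l * m * n : ℕ) : ℤ) : ℝ) := by exact_mod_cast h2a
      have h2 : (a : ℝ) ≤ |(a : ℝ)| := le_abs_self _
      push_cast at h1 ⊢
      linarith
    have hdenpos : (0 : ℝ) < ((l * m * n : ℕ) : ℝ) - a := by linarith
    -- `τ(|a| lmn) ≤ τ(|a|) τ(l) τ(m) τ(n)`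
    have hτ : (σ 0 (a.natAbs * (l * m * n)) : ℝ) ≤ (σ 0 a.natAbs : ℝ) * ((σ 0 l : ℝ) * σ 0 m * σ 0 n) := by
      have h1 := sigma_zero_mul_le a.natAbs (l * m * n)
      have h2 := sigma_zero_mul_le (l * m) n
      have h3 := sigma_zero_mul_le l m
      have : σ 0 (a.natAbs * (l * m * n)) ≤ σ 0 a.natAbs * (σ 0 l * σ 0 m * σ 0 n) :=
        h1.trans (Nat.mul_le_mul_left _ (h2.trans (Nat.mul_le_mul_right _ h3)))
      exact_mod_cast this
    unfold merrTerm
    have hfrac : (Q' * r : ℝ) / (((l * m * n : ℕ) : ℝ) - a) ≤ 2 * Q' * r / ((l : ℝ) * m * n) := by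
      rw [div_le_div_iff₀ hdenpos hlmn0]
      have : (0 : ℝ) ≤ Q' * r := by positivity
      nlinarith
    calc merrConst a S * (σ 0 (a.natAbs * (l * m * n)) : ℝ) * totInvSum (S + 2 * Q') *
          ((Q' * r : ℝ) / (((l * m * n : ℕ) : ℝ) - a) + 1 / Q') / Nat.totient r
        ≤ merrConst a S * ((σ 0 a.natAbs : ℝ) * ((σ 0 l : ℝ) * σ 0 m * σ 0 n)) * totInvSum (S + 2 * Q') *
          (2 * Q' * r / ((l : ℝ) * m * n) + 1 / Q') / Nat.totient r := by
          apply div_le_div_of_nonneg_right _ hφr.le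
          apply mul_le_mul (mul_le_mul_of_nonneg_right (mul_le_mul_of_nonneg_left hτ hmc) hΦ)
            (by linarith) (by positivity) (by positivity)
      _ = _ := by rw [hK₀]; field_simp
  -- Step 2: sum level by level
  have hlevel : ∑ r ∈ Ioc rlo R, ∑ l ∈ Icc 1 L, ∑ m ∈ Ioc mlo M', ∑ n ∈ Ioc nlo N',
      ((K₀ * (2 * Q') * ((r : ℝ) / Nat.totient r) * ((σ 0 l : ℝ) / l) * ((σ 0 m : ℝ) / m)) * ((σ 0 n : ℝ) / n) +
        (K₀ * (1 / Q') * ((1 : ℝ) / Nat.totient r) * (σ 0 l : ℝ) * (σ 0 m : ℝ)) * (σ 0 n : ℝ)) =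
      K₀ * (2 * Q') * Ar * Dl * Dm * Dn + K₀ * (1 / Q') * Br * El * Em * En := by
    have hn : ∀ r l m : ℕ, ∑ n ∈ Ioc nlo N',
        ((K₀ * (2 * Q') * ((r : ℝ) / Nat.totient r) * ((σ 0 l : ℝ) / l) * ((σ 0 m : ℝ) / m)) * ((σ 0 n : ℝ) / n) +
          (K₀ * (1 / Q') * ((1 : ℝ) / Nat.totient r) * (σ 0 l : ℝ) * (σ 0 m : ℝ)) * (σ 0 n : ℝ)) =
        (K₀ * (2 * Q') * ((r : ℝ) / Nat.totient r) * ((σ 0 l : ℝ) / l) * ((σ 0 m : ℝ) / m)) * Dn +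
          (K₀ * (1 / Q') * ((1 : ℝ) / Nat.totient r) * (σ 0 l : ℝ) * (σ 0 m : ℝ)) * En := by
      intro r l m
      rw [Finset.sum_add_distrib, ← Finset.mul_sum, ← Finset.mul_sum]
    have hm : ∀ r l : ℕ, ∑ m ∈ Ioc mlo M',
        ((K₀ * (2 * Q') * ((r : ℝ) / Nat.totient r) * ((σ 0 l : ℝ) / l) * ((σ 0 m : ℝ) / m)) * Dn +
          (K₀ * (1 / Q') * ((1 : ℝ) / Nat.totient r) * (σ 0 l : ℝ) * (σ 0 m : ℝ)) * En) =
        (K₀ * (2 * Q') * ((r : ℝ) / Nat.totient r) * ((σ 0 l : ℝ) / l) * Dn) * Dm +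
          (K₀ * (1 / Q') * ((1 : ℝ) / Nat.totient r) * (σ 0 l : ℝ) * En) * Em := by
      intro r l
      rw [Finset.sum_add_distrib]
      congr 1
      · rw [hDm, Finset.mul_sum]; exact Finset.sum_congr rfl fun m _ => by ring
      · rw [hEm, Finset.mul_sum]; exact Finset.sum_congr rfl fun m _ => by ring
    have hl : ∀ r : ℕ, ∑ l ∈ Icc 1 L,
        ((K₀ * (2 * Q') * ((r : ℝ) / Nat.totient r) * ((σ 0 l : ℝ) / l) * Dn) * Dm +
          (K₀ * (1 / Q') * ((1 : ℝ) / Nat.totient r) * (σ 0 l : ℝ) * En) * Em) =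
        (K₀ * (2 * Q') * ((r : ℝ) / Nat.totient r) * Dn * Dm) * Dl +
          (K₀ * (1 / Q') * ((1 : ℝ) / Nat.totient r) * En * Em) * El := by
      intro r
      rw [Finset.sum_add_distrib]
      congr 1
      · rw [hDl, Finset.mul_sum]; exact Finset.sum_congr rfl fun l _ => by ring
      · rw [hEl, Finset.mul_sum]; exact Finset.sum_congr rfl fun l _ => by ring
    have hr : ∑ r ∈ Ioc rlo R,
        ((K₀ * (2 * Q') * ((r : ℝ) / Nat.totient r) * Dn * Dm) * Dl +
          (K₀ * (1 / Q') * ((1 : ℝ) / Nat.totient r) * En * Em) * El) =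
        K₀ * (2 * Q') * Ar * Dl * Dm * Dn + K₀ * (1 / Q') * Br * El * Em * En := by
      rw [Finset.sum_add_distrib]
      have e1 : ∑ r ∈ Ioc rlo R, (K₀ * (2 * Q') * ((r : ℝ) / Nat.totient r) * Dn * Dm) * Dl =
          ∑ r ∈ Ioc rlo R, (K₀ * (2 * Q') * Dn * Dm * Dl) * ((r : ℝ) / Nat.totient r) :=
        Finset.sum_congr rfl fun r _ => by ring
      have e2 : ∑ r ∈ Ioc rlo R, (K₀ * (1 / Q') * ((1 : ℝ) / Nat.totient r) * En * Em) * El =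
          ∑ r ∈ Ioc rlo R, (K₀ * (1 / Q') * En * Em * El) * ((1 : ℝ) / Nat.totient r) :=
        Finset.sum_congr rfl fun r _ => by ring
      rw [e1, e2, ← Finset.mul_sum, ← Finset.mul_sum, ← hAr, ← hBr]
      ring
    rw [Finset.sum_congr rfl fun r _ => Finset.sum_congr rfl fun l _ => Finset.sum_congr rfl fun m _ => hn r l m]
    rw [Finset.sum_congr rfl fun r _ => Finset.sum_congr rfl fun l _ => hm r l]
    rw [Finset.sum_congr rfl fun r _ => hl r, hr]
  -- Step 3: the divisor sums
  obtain ⟨hSR, hSRd, -, -⟩ := hC R Y hR hY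
  obtain ⟨hSL, hSLd, -, -⟩ := hC L Y hL hY
  obtain ⟨hSM, hSMd, -, -⟩ := hC M' Y hM hY
  obtain ⟨hSN, hSNd, -, -⟩ := hC N' Y hN hY
  have hAr_le : Ar ≤ C * ((R : ℝ) + 2) * Real.log Y ^ 4 := by
    calc Ar ≤ ∑ r ∈ Icc 1 R, (σ 0 r : ℝ) := by
          refine (Finset.sum_le_sum_of_subset_of_nonneg (fun r hr => ?_) fun _ _ _ => by positivity).trans
            (Finset.sum_le_sum fun r hr => (div_totient_le_sigma r (Finset.mem_Icc.1 hr).1).1)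
          rw [Finset.mem_Ioc] at hr; rw [Finset.mem_Icc]; omega
      _ ≤ _ := hSR
  have hBr_le : Br ≤ C * Real.log Y ^ 4 := by
    calc Br ≤ ∑ r ∈ Icc 1 R, (σ 0 r : ℝ) / r := by
          refine (Finset.sum_le_sum_of_subset_of_nonneg (fun r hr => ?_) fun _ _ _ => by positivity).trans
            (Finset.sum_le_sum fun r hr => (div_totient_le_sigma r (Finset.mem_Icc.1 hr).1).2)
          rw [Finset.mem_Ioc] at hr; rw [Finset.mem_Icc]; omega
      _ ≤ _ := hSRd
  have hsubM : Ioc mlo M' ⊆ Icc 1 M' := fun m hm => by rw [Finset.mem_Ioc] at hm; rw [Finset.mem_Icc]; omega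
  have hsubN : Ioc nlo N' ⊆ Icc 1 N' := fun n hn => by rw [Finset.mem_Ioc] at hn; rw [Finset.mem_Icc]; omega
  have hEm_le : Em ≤ C * ((M' : ℝ) + 2) * Real.log Y ^ 4 :=
    (Finset.sum_le_sum_of_subset_of_nonneg hsubM fun _ _ _ => by positivity).trans hSM
  have hEn_le : En ≤ C * ((N' : ℝ) + 2) * Real.log Y ^ 4 :=
    (Finset.sum_le_sum_of_subset_of_nonneg hsubN fun _ _ _ => by positivity).trans hSN
  have hDm_le : Dm ≤ C * Real.log Y ^ 4 :=
    (Finset.sum_le_sum_of_subset_of_nonneg hsubM fun _ _ _ => by positivity).trans hSMd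
  have hDn_le : Dn ≤ C * Real.log Y ^ 4 :=
    (Finset.sum_le_sum_of_subset_of_nonneg hsubN fun _ _ _ => by positivity).trans hSNd
  -- Step 4: assemble
  calc ∑ r ∈ Ioc rlo R, ∑ l ∈ Icc 1 L, ∑ m ∈ Ioc mlo M', ∑ n ∈ Ioc nlo N', merrTerm a S Q' r l m n
      ≤ ∑ r ∈ Ioc rlo R, ∑ l ∈ Icc 1 L, ∑ m ∈ Ioc mlo M', ∑ n ∈ Ioc nlo N',
          ((K₀ * (2 * Q') * ((r : ℝ) / Nat.totient r) * ((σ 0 l : ℝ) / l) * ((σ 0 m : ℝ) / m)) * ((σ 0 n : ℝ) / n) +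
            (K₀ * (1 / Q') * ((1 : ℝ) / Nat.totient r) * (σ 0 l : ℝ) * (σ 0 m : ℝ)) * (σ 0 n : ℝ)) :=
        Finset.sum_le_sum fun r hr => Finset.sum_le_sum fun l hl => Finset.sum_le_sum fun m hm =>
          Finset.sum_le_sum fun n hn => hterm r hr l hl m hm n hn
    _ = K₀ * (2 * Q') * Ar * Dl * Dm * Dn + K₀ * (1 / Q') * Br * El * Em * En := hlevel
    _ ≤ K₀ * (2 * Q') * ((C * ((R : ℝ) + 2) * Real.log Y ^ 4) * (C * Real.log Y ^ 4) * (C * Real.log Y ^ 4) *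
          (C * Real.log Y ^ 4)) +
        K₀ * (1 / Q') * ((C * Real.log Y ^ 4) * (C * ((L : ℝ) + 2) * Real.log Y ^ 4) *
          (C * ((M' : ℝ) + 2) * Real.log Y ^ 4) * (C * ((N' : ℝ) + 2) * Real.log Y ^ 4)) := by
        have hP1 : Ar * Dl * Dm * Dn ≤ (C * ((R : ℝ) + 2) * Real.log Y ^ 4) * (C * Real.log Y ^ 4) *
            (C * Real.log Y ^ 4) * (C * Real.log Y ^ 4) :=
          mul_le_mul (mul_le_mul (mul_le_mul hAr_le hSLd h0Dl (by positivity)) hDm_le h0Dm (by positivity))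
            hDn_le h0Dn (by positivity)
        have hP2 : Br * El * Em * En ≤ (C * Real.log Y ^ 4) * (C * ((L : ℝ) + 2) * Real.log Y ^ 4) *
            (C * ((M' : ℝ) + 2) * Real.log Y ^ 4) * (C * ((N' : ℝ) + 2) * Real.log Y ^ 4) :=
          mul_le_mul (mul_le_mul (mul_le_mul hBr_le hSL h0El (by positivity)) hEm_le h0Em (by positivity))
            hEn_le h0En (by positivity)
        have e1 : K₀ * (2 * Q') * Ar * Dl * Dm * Dn = K₀ * (2 * Q') * (Ar * Dl * Dm * Dn) := by ring
        have e2 : K₀ * (1 / Q') * Br * El * Em * En = K₀ * (1 / Q') * (Br * El * Em * En) := by ring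
        rw [e1, e2]
        exact add_le_add (mul_le_mul_of_nonneg_left hP1 (by positivity)) (mul_le_mul_of_nonneg_left hP2 (by positivity))
    _ = merrConst a S * totInvSum (S + 2 * Q') * (σ 0 a.natAbs : ℝ) * C ^ 4 * Real.log Y ^ 16 *
        (2 * Q' * ((R : ℝ) + 2) + ((L : ℝ) + 2) * ((M' : ℝ) + 2) * ((N' : ℝ) + 2) / Q') := by
        rw [hK₀]; ring

/-! ### The ambiguous `A`-part: `∑ ρ_J(K̃)` over a switched piece -/

/-- Triples with an injective relabelling of the first coordinate: `#{(l,m,n) : f(l) m n = k} ≤ τ(k)²`.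
[folklore] -/
theorem card_triples_relabel_le {k : ℕ} (hk : k ≠ 0) (IL IM IN : Finset ℕ) (f : ℕ → ℕ) (hf : Set.InjOn f IL) :
    ((IL ×ˢ (IM ×ˢ IN)).filter (fun p : ℕ × (ℕ × ℕ) => f p.1 * p.2.1 * p.2.2 = k)).card ≤ k.divisors.card ^ 2 := by
  classical
  rw [sq, ← Finset.card_product]
  refine Finset.card_le_card_of_injOn (fun p => (f p.1, p.2.1)) (fun p hp => ?_) ?_
  · rw [Finset.mem_coe, Finset.mem_filter] at hp
    obtain ⟨-, hp⟩ := hp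
    rw [Finset.mem_coe, Finset.mem_product, Nat.mem_divisors, Nat.mem_divisors]
    exact ⟨⟨⟨p.2.1 * p.2.2, by rw [← hp]; ring⟩, hk⟩, ⟨⟨f p.1 * p.2.2, by rw [← hp]; ring⟩, hk⟩⟩
  · intro p₁ hp₁ p₂ hp₂ heq
    rw [Finset.mem_coe, Finset.mem_filter, Finset.mem_product, Finset.mem_product] at hp₁ hp₂
    simp only [Prod.mk.injEq] at heq
    obtain ⟨h1, h2⟩ := heq
    have hl : p₁.1 = p₂.1 := hf hp₁.1.1 hp₂.1.1 h1
    have hx0 : f p₁.1 * p₁.2.1 ≠ 0 := by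
      intro h0; apply hk; rw [← hp₁.2, h0, zero_mul]
    have hn : p₁.2.2 = p₂.2.2 := by
      have e1 := hp₁.2; have e2 := hp₂.2
      rw [← h1, ← h2] at e2
      exact Nat.eq_of_mul_eq_mul_left (Nat.pos_of_ne_zero hx0) (e1.trans e2.symm)
    exact Prod.ext hl (Prod.ext h2 hn)

/-- **Multiplicities of `K̃`**: for `p = (l, m, n) ∈ Splus`,
`valMult(K̃(p)) ≤ τ(D_m D_n)² τ(l)² τ(m)² τ(n)²`. [folklore] -/
theorem valMult_Ktil_le {a : ℤ} (ha : a ≠ 0) {mlo M' nlo N' L d g : ℕ} (hd : d ∣ a.natAbs)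
    (hgΘ : g ∣ ThetaD a.natAbs d) (v : List ℕ) {t : ℤ × ℕ × ℕ} (ht : t ∈ Tsel a d g (profFun a v))
    {p : ℕ × (ℕ × ℕ)} (hp : p ∈ Splus a mlo M' nlo N' L d g t v) :
    ((valMult (Splus a mlo M' nlo N' L d g t v) (Ktil a d g t) (Ktil a d g t p) : ℕ) : ℝ) ≤
      (σ 0 (t.2.1 * t.2.2) : ℝ) ^ 2 * (σ 0 p.1 : ℝ) ^ 2 * (σ 0 p.2.1 : ℝ) ^ 2 * (σ 0 p.2.2 : ℝ) ^ 2 := by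
  classical
  obtain ⟨-, hterms, hident⟩ := Tsel_spec ha hd hgΘ (profFun a v)
  obtain ⟨-, hDm, hDn, -⟩ := hterms t ht
  have hE0 : 0 < Ea a d g := Ea_pos a d g
  -- `E ∣ l Dm Dn` on the profile class
  have hEdvd : ∀ l ∈ (Icc 1 L).filter (fun l : ℕ => profVec a l = v), Ea a d g ∣ l * t.2.1 * t.2.2 := by
    intro l hl
    rw [Finset.mem_filter, Finset.mem_Icc] at hl
    have hprof : profOf a l = profFun a v := by rw [← hl.2, profFun_profVec]
    obtain ⟨h1, -⟩ := hident l hl.1.1 (fun q hq => by rw [← hprof]; exact profOf_apply_of_mem hq)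
    exact h1 t ht
  have hinj : Set.InjOn (lred a d g t) ((Icc 1 L).filter (fun l : ℕ => profVec a l = v)) := by
    intro l₁ hl₁ l₂ hl₂ h
    simp only [lred] at h
    have h1 := Nat.div_mul_cancel (hEdvd l₁ hl₁)
    have h2 := Nat.div_mul_cancel (hEdvd l₂ hl₂)
    have : l₁ * t.2.1 * t.2.2 = l₂ * t.2.1 * t.2.2 := by rw [← h1, ← h2, h]
    rw [mul_assoc, mul_assoc] at this
    exact Nat.eq_of_mul_eq_mul_right (Nat.mul_pos hDm hDn) this
  -- the value of `K̃` on `Splus`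
  have hKval : ∀ q ∈ Splus a mlo M' nlo N' L d g t v,
      ((Ktil a d g t q : ℕ) : ℤ) = ((lred a d g t q.1 * q.2.1 * q.2.2 : ℕ) : ℤ) - a / (Ea a d g : ℤ) := by
    intro q hq
    unfold Splus at hq
    rw [Finset.mem_filter] at hq
    have h1 : 1 ≤ Ktil a d g t q := hq.2
    unfold Ktil at h1 ⊢
    have : 0 < ((((lred a d g t q.1 * q.2.1 * q.2.2 : ℕ)) : ℤ) - a / (Ea a d g : ℤ)) := by
      by_contra hle; push Not at hle
      rw [Int.toNat_of_nonpos hle] at h1; omega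
    exact Int.toNat_of_nonneg this.le
  set k₀ := lred a d g t p.1 * p.2.1 * p.2.2 with hk₀
  have hpS := hp
  unfold Splus at hpS
  rw [Finset.mem_filter, Finset.mem_product, Finset.mem_product] at hpS
  obtain ⟨⟨hpl, hpm, hpn⟩, hpK⟩ := hpS
  have hl0 : 0 < p.1 := (Finset.mem_Icc.1 (Finset.mem_filter.1 hpl).1).1
  have hm0 : 0 < p.2.1 := Nat.lt_of_le_of_lt (Nat.zero_le _) (Finset.mem_Ioc.1 hpm).1
  have hn0 : 0 < p.2.2 := Nat.lt_of_le_of_lt (Nat.zero_le _) (Finset.mem_Ioc.1 hpn).1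
  have hlred0 : 0 < lred a d g t p.1 := by
    unfold lred
    exact Nat.div_pos (Nat.le_of_dvd (Nat.mul_pos (Nat.mul_pos hl0 hDm) hDn) (hEdvd p.1 hpl)) hE0
  have hk0 : k₀ ≠ 0 := (Nat.mul_pos (Nat.mul_pos hlred0 hm0) hn0).ne'
  -- the fibre is contained in the triples with `f(l) m n = k₀`
  have hsub : (Splus a mlo M' nlo N' L d g t v).filter (fun q => Ktil a d g t q = Ktil a d g t p) ⊆
      (((Icc 1 L).filter (fun l : ℕ => profVec a l = v)) ×ˢ
        ((Ioc (mlo / t.2.1) (M' / t.2.1)) ×ˢ (Ioc (nlo / t.2.2) (N' / t.2.2)))).filter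
        (fun q : ℕ × (ℕ × ℕ) => lred a d g t q.1 * q.2.1 * q.2.2 = k₀) := by
    intro q hq
    rw [Finset.mem_filter] at hq
    obtain ⟨hqS, hqK⟩ := hq
    have hv1 := hKval q hqS
    have hv2 := hKval p hp
    rw [hqK] at hv1
    have : ((lred a d g t q.1 * q.2.1 * q.2.2 : ℕ) : ℤ) = ((k₀ : ℕ) : ℤ) := by rw [hk₀]; linarith
    have hqS' := hqS
    unfold Splus at hqS'
    rw [Finset.mem_filter] at hqS'
    rw [Finset.mem_filter]
    exact ⟨hqS'.1, by exact_mod_cast this⟩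
  unfold valMult
  calc ((((Splus a mlo M' nlo N' L d g t v).filter (fun q => Ktil a d g t q = Ktil a d g t p)).card : ℕ) : ℝ)
      ≤ (((((Icc 1 L).filter (fun l : ℕ => profVec a l = v)) ×ˢ
          ((Ioc (mlo / t.2.1) (M' / t.2.1)) ×ˢ (Ioc (nlo / t.2.2) (N' / t.2.2)))).filter
          (fun q : ℕ × (ℕ × ℕ) => lred a d g t q.1 * q.2.1 * q.2.2 = k₀)).card : ℝ) := by
        exact_mod_cast Finset.card_le_card hsub
    _ ≤ ((k₀.divisors.card ^ 2 : ℕ) : ℝ) := by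
        exact_mod_cast card_triples_relabel_le hk0 _ _ _ (lred a d g t) hinj
    _ = (σ 0 k₀ : ℝ) ^ 2 := by rw [Nat.cast_pow, ArithmeticFunction.sigma_zero_apply]
    _ ≤ ((σ 0 (t.2.1 * t.2.2) : ℝ) * (σ 0 p.1 : ℝ) * (σ 0 p.2.1 : ℝ) * (σ 0 p.2.2 : ℝ)) ^ 2 := by
        apply pow_le_pow_left₀ (by positivity)
        -- `τ(k₀) ≤ τ(l̃) τ(m) τ(n) ≤ τ(l Dm Dn) τ(m) τ(n) ≤ τ(Dm Dn) τ(l) τ(m) τ(n)`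
        have h1 : σ 0 k₀ ≤ σ 0 (lred a d g t p.1) * σ 0 p.2.1 * σ 0 p.2.2 :=
          (sigma_zero_mul_le _ _).trans (Nat.mul_le_mul_right _ (sigma_zero_mul_le _ _))
        have h2 : σ 0 (lred a d g t p.1) ≤ σ 0 (p.1 * t.2.1 * t.2.2) :=
          sigma_zero_le_of_dvd (Nat.mul_pos (Nat.mul_pos hl0 hDm) hDn).ne' (Nat.div_dvd_of_dvd (hEdvd p.1 hpl))
        have h3 : σ 0 (p.1 * t.2.1 * t.2.2) ≤ σ 0 (t.2.1 * t.2.2) * σ 0 p.1 := by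
          rw [show p.1 * t.2.1 * t.2.2 = (t.2.1 * t.2.2) * p.1 by ring]; exact sigma_zero_mul_le _ _
        have : σ 0 k₀ ≤ σ 0 (t.2.1 * t.2.2) * σ 0 p.1 * σ 0 p.2.1 * σ 0 p.2.2 :=
          h1.trans (Nat.mul_le_mul_right _ (Nat.mul_le_mul_right _ (h2.trans h3)))
        exact_mod_cast this
    _ = _ := by ring

/-- **`∑_{p ∈ Splus} valMult(K̃(p)) ≤ τ(Amax)² (∑_{l ≤ L} τ²)(∑_{m ≤ M'} τ²)(∑_{n ≤ N'} τ²)`.** [folklore] -/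
theorem sum_valMult_Ktil_le {a : ℤ} (ha : a ≠ 0) {mlo M' nlo N' L d g : ℕ} (hd : d ∣ a.natAbs)
    (hgΘ : g ∣ ThetaD a.natAbs d) (v : List ℕ) {t : ℤ × ℕ × ℕ} (ht : t ∈ Tsel a d g (profFun a v)) :
    ∑ p ∈ Splus a mlo M' nlo N' L d g t v,
        ((valMult (Splus a mlo M' nlo N' L d g t v) (Ktil a d g t) (Ktil a d g t p) : ℕ) : ℝ) ≤
      (σ 0 (Amax a) : ℝ) ^ 2 * ((∑ l ∈ Icc 1 L, (σ 0 l : ℝ) ^ 2) * (∑ m ∈ Icc 1 M', (σ 0 m : ℝ) ^ 2) *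
        (∑ n ∈ Icc 1 N', (σ 0 n : ℝ) ^ 2)) := by
  classical
  obtain ⟨-, hterms, -⟩ := Tsel_spec ha hd hgΘ (profFun a v)
  obtain ⟨-, hDm, hDn, hdvd⟩ := hterms t ht
  have hA0 : Amax a ≠ 0 := (Finset.prod_pos fun p hp => pow_pos (prime_of_mem_psA (List.mem_toFinset.1 hp)).pos _).ne'
  have hτD : (σ 0 (t.2.1 * t.2.2) : ℝ) ≤ σ 0 (Amax a) := by exact_mod_cast sigma_zero_le_of_dvd hA0 hdvd
  calc ∑ p ∈ Splus a mlo M' nlo N' L d g t v,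
        ((valMult (Splus a mlo M' nlo N' L d g t v) (Ktil a d g t) (Ktil a d g t p) : ℕ) : ℝ)
      ≤ ∑ p ∈ Splus a mlo M' nlo N' L d g t v,
          (σ 0 (Amax a) : ℝ) ^ 2 * ((σ 0 p.1 : ℝ) ^ 2 * ((σ 0 p.2.1 : ℝ) ^ 2 * (σ 0 p.2.2 : ℝ) ^ 2)) := by
        refine Finset.sum_le_sum fun p hp => (valMult_Ktil_le ha hd hgΘ v ht hp).trans ?_
        have : (σ 0 (t.2.1 * t.2.2) : ℝ) ^ 2 ≤ (σ 0 (Amax a) : ℝ) ^ 2 := pow_le_pow_left₀ (by positivity) hτD 2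
        calc (σ 0 (t.2.1 * t.2.2) : ℝ) ^ 2 * (σ 0 p.1 : ℝ) ^ 2 * (σ 0 p.2.1 : ℝ) ^ 2 * (σ 0 p.2.2 : ℝ) ^ 2
            = (σ 0 (t.2.1 * t.2.2) : ℝ) ^ 2 * ((σ 0 p.1 : ℝ) ^ 2 * ((σ 0 p.2.1 : ℝ) ^ 2 * (σ 0 p.2.2 : ℝ) ^ 2)) := by ring
          _ ≤ _ := mul_le_mul_of_nonneg_right this (by positivity)
    _ ≤ ∑ p ∈ (Icc 1 L) ×ˢ ((Icc 1 M') ×ˢ (Icc 1 N')),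
          (σ 0 (Amax a) : ℝ) ^ 2 * ((σ 0 p.1 : ℝ) ^ 2 * ((σ 0 p.2.1 : ℝ) ^ 2 * (σ 0 p.2.2 : ℝ) ^ 2)) := by
        refine Finset.sum_le_sum_of_subset_of_nonneg ?_ fun _ _ _ => by positivity
        intro p hp
        unfold Splus at hp
        rw [Finset.mem_filter, Finset.mem_product, Finset.mem_product, Finset.mem_filter] at hp
        obtain ⟨⟨⟨hl, -⟩, hm, hn⟩, -⟩ := hp
        have hm' := Finset.mem_Ioc.1 hm
        have hn' := Finset.mem_Ioc.1 hn
        simp only [Finset.mem_product, Finset.mem_Icc]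
        refine ⟨Finset.mem_Icc.1 hl, ⟨?_, hm'.2.trans (Nat.div_le_self _ _)⟩, ⟨?_, hn'.2.trans (Nat.div_le_self _ _)⟩⟩
        · exact Nat.lt_of_le_of_lt (Nat.zero_le _) hm'.1
        · exact Nat.lt_of_le_of_lt (Nat.zero_le _) hn'.1
    _ = _ := by
        rw [← Finset.mul_sum]
        congr 1
        rw [Finset.sum_product]
        calc ∑ l ∈ Icc 1 L, ∑ q ∈ Icc 1 M' ×ˢ Icc 1 N',
              (σ 0 (l, q).1 : ℝ) ^ 2 * ((σ 0 (l, q).2.1 : ℝ) ^ 2 * (σ 0 (l, q).2.2 : ℝ) ^ 2)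
            = ∑ l ∈ Icc 1 L, (σ 0 l : ℝ) ^ 2 * ((∑ m ∈ Icc 1 M', (σ 0 m : ℝ) ^ 2) * (∑ n ∈ Icc 1 N', (σ 0 n : ℝ) ^ 2)) := by
              refine Finset.sum_congr rfl fun l _ => ?_
              rw [Finset.sum_mul_sum, ← Finset.sum_product', Finset.mul_sum]
        _ = _ := by rw [← Finset.sum_mul]; ring

/-- **`K̃ ≤ S` on `Splus`** when `L M' N' + |a| ≤ S`. [folklore] -/
theorem Ktil_le_of_mem_Splus {a : ℤ} (ha : a ≠ 0) {mlo M' nlo N' L d g S : ℕ} (t : ℤ × ℕ × ℕ) (v : List ℕ)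
    (hS : L * M' * N' + a.natAbs ≤ S) {p : ℕ × (ℕ × ℕ)} (hp : p ∈ Splus a mlo M' nlo N' L d g t v) :
    Ktil a d g t p ∈ Icc 1 S := by
  unfold Splus at hp
  rw [Finset.mem_filter, Finset.mem_product, Finset.mem_product, Finset.mem_filter, Finset.mem_Icc] at hp
  obtain ⟨⟨⟨⟨-, hlL⟩, -⟩, hm, hn⟩, hK1⟩ := hp
  rw [Finset.mem_Icc]
  refine ⟨hK1, ?_⟩
  have hm' := (Finset.mem_Ioc.1 hm).2
  have hn' := (Finset.mem_Ioc.1 hn).2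
  -- `l̃ m n ≤ (l Dm Dn/E) m n ≤ l (Dm m)(Dn n) ≤ L M' N'`
  have h1 : lred a d g t p.1 * p.2.1 * p.2.2 ≤ L * M' * N' := by
    unfold lred
    calc p.1 * t.2.1 * t.2.2 / Ea a d g * p.2.1 * p.2.2 ≤ p.1 * t.2.1 * t.2.2 * p.2.1 * p.2.2 :=
          Nat.mul_le_mul_right _ (Nat.mul_le_mul_right _ (Nat.div_le_self _ _))
      _ = p.1 * (t.2.1 * p.2.1) * (t.2.2 * p.2.2) := by ring
      _ ≤ L * M' * N' := by
          apply Nat.mul_le_mul (Nat.mul_le_mul hlL _) _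
          · exact (Nat.mul_le_mul_left _ hm').trans (Nat.mul_div_le M' t.2.1)
          · exact (Nat.mul_le_mul_left _ hn').trans (Nat.mul_div_le N' t.2.2)
  unfold Ktil
  have hEa : (Ea a d g : ℤ) ∣ a := Int.natCast_dvd.2 (Ered_dvd (fun _ hp => prime_of_mem_psA hp) ha _)
  have hã : -(a / (Ea a d g : ℤ)) ≤ a.natAbs := by
    have h2 : (a / (Ea a d g : ℤ)).natAbs ≤ a.natAbs := by
      rw [Int.natAbs_ediv_of_dvd hEa, Int.natAbs_natCast]
      exact Nat.div_le_self _ _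
    have h3 : -(a / (Ea a d g : ℤ)) ≤ ((a / (Ea a d g : ℤ)).natAbs : ℤ) := by
      have := Int.le_natAbs (a := -(a / (Ea a d g : ℤ))); rwa [Int.natAbs_neg] at this
    have h4 : (((a / (Ea a d g : ℤ)).natAbs : ℕ) : ℤ) ≤ a.natAbs := by exact_mod_cast h2
    linarith
  have : ((((lred a d g t p.1 * p.2.1 * p.2.2 : ℕ)) : ℤ) - a / (Ea a d g : ℤ)) ≤ (S : ℤ) := by
    have h5 : ((lred a d g t p.1 * p.2.1 * p.2.2 : ℕ) : ℤ) ≤ ((L * M' * N' : ℕ) : ℤ) := by exact_mod_cast h1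
    have h6 : ((L * M' * N' : ℕ) : ℤ) + a.natAbs ≤ S := by exact_mod_cast hS
    linarith
  exact (Int.toNat_le_toNat this).trans (by simp)

/-- The window endpoint `A₁ = 2Q'g c₁/(EP c₂)`. [folklore] -/
def wA1 (Q' g E P c₁ c₂ : ℕ) : ℕ := 2 * Q' * g * c₁ / (E * P * c₂)

/-- The window endpoint `B₁ = 2Q'g/(EP)`. [folklore] -/
def wB1 (Q' g E P : ℕ) : ℕ := 2 * Q' * g / (E * P)

/-- The window endpoint `A₂ = Q'g/(EP)`. [folklore] -/
def wA2 (Q' g E P : ℕ) : ℕ := Q' * g / (E * P)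

/-- The window endpoint `B₂ = Q'g c₂/(EP c₁)`. [folklore] -/
def wB2 (Q' g E P c₁ c₂ : ℕ) : ℕ := Q' * g * c₂ / (E * P * c₁)

/-- `Jfix = (A₁, B₁] ∪ (A₂, B₂]`. [folklore] -/
theorem Jfix_eq (Q' g E P c₁ c₂ : ℕ) :
    Jfix Q' g E P c₁ c₂ = Ioc (wA1 Q' g E P c₁ c₂) (wB1 Q' g E P) ∪ Ioc (wA2 Q' g E P) (wB2 Q' g E P c₁ c₂) := rfl

/-- The second-moment factor of the `A`-part bound (see `sum_rhoJ_Splus_le`). [folklore] -/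
def rhoFactor (CS : ℝ) (Q' g E P c₁ c₂ S R : ℕ) (C : ℝ) (Y : ℕ) : ℝ :=
  (S : ℝ) * ((1 + Real.log R) *
    ((((wB1 Q' g E P - wA1 Q' g E P c₁ c₂ : ℕ)) : ℝ) + ((wB2 Q' g E P c₁ c₂ - wA2 Q' g E P : ℕ) : ℝ) +
      2 * ((max (wB1 Q' g E P) (wB2 Q' g E P c₁ c₂) : ℕ) : ℝ)) /
      ((P : ℝ) * ((min (wA1 Q' g E P c₁ c₂) (wA2 Q' g E P) : ℕ) : ℝ))) *
  ((C * Real.log Y ^ 8) *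
    ((CS * max ((wB1 Q' g E P : ℝ) - (wA1 Q' g E P c₁ c₂ : ℝ)) (Real.sqrt (wA1 Q' g E P c₁ c₂)) *
        Real.log (wA1 Q' g E P c₁ c₂) ^ 3 +
      CS * max ((wB2 Q' g E P c₁ c₂ : ℝ) - (wA2 Q' g E P : ℝ)) (Real.sqrt (wA2 Q' g E P)) *
        Real.log (wA2 Q' g E P) ^ 3) /
      ((min (wA1 Q' g E P c₁ c₂) (wA2 Q' g E P) : ℕ) : ℝ)))

/-- **The `A`-part of one reduction term**: Cauchy–Schwarz with the second moment of `ρ_J` and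
Shiu's theorem on the two short windows of `Jfix = (A₁, B₁] ∪ (A₂, B₂]`. [cite: BombieriFriedlanderIwaniecActa1986, §13 p. 241–242] -/
theorem sum_rhoJ_Splus_le {C : ℝ} (hC1 : 1 ≤ C)
    (hC : ∀ X Y : ℕ, X ≤ Y → 2 ≤ Y →
      (∑ n ∈ Icc 1 X, (σ 0 n : ℝ)) ≤ C * ((X : ℝ) + 2) * Real.log Y ^ 4 ∧
      (∑ n ∈ Icc 1 X, (σ 0 n : ℝ) / n) ≤ C * Real.log Y ^ 4 ∧
      (∑ n ∈ Icc 1 X, (σ 0 n : ℝ) ^ 2) ≤ C * ((X : ℝ) + 2) * Real.log Y ^ 8 ∧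
      (∑ n ∈ Icc 1 X, (σ 0 n : ℝ) ^ 2 / n) ≤ C * Real.log Y ^ 8)
    {CS x₀ : ℝ}
    (hShiu : ∀ A B : ℕ, x₀ ≤ (A : ℝ) → A ≤ B → B ≤ 2 * A →
      ∑ q ∈ Ioc A B, (σ 0 q : ℝ) ^ 2 ≤ CS * max ((B : ℝ) - A) (Real.sqrt A) * Real.log A ^ 3)
    {a : ℤ} (ha : a ≠ 0) {mlo M' nlo N' L R S d g Q' c₁ c₂ Y : ℕ} (hd : d ∣ a.natAbs)
    (hgΘ : g ∣ ThetaD a.natAbs d) (v : List ℕ) {t : ℤ × ℕ × ℕ} (ht : t ∈ Tsel a d g (profFun a v))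
    (hS : L * M' * N' + a.natAbs ≤ S) (hR : 1 ≤ R) (hY : 2 ≤ Y) (hLY : L ≤ Y) (hMY : M' ≤ Y) (hNY : N' ≤ Y) (hRY : R ≤ Y)
    (hQ₀ : 0 < min (wA1 Q' g (Ea a d g) (Pa a d g) c₁ c₂) (wA2 Q' g (Ea a d g) (Pa a d g)))
    (hw1 : x₀ ≤ (wA1 Q' g (Ea a d g) (Pa a d g) c₁ c₂ : ℝ) ∧
      wA1 Q' g (Ea a d g) (Pa a d g) c₁ c₂ ≤ wB1 Q' g (Ea a d g) (Pa a d g) ∧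
      wB1 Q' g (Ea a d g) (Pa a d g) ≤ 2 * wA1 Q' g (Ea a d g) (Pa a d g) c₁ c₂)
    (hw2 : x₀ ≤ (wA2 Q' g (Ea a d g) (Pa a d g) : ℝ) ∧
      wA2 Q' g (Ea a d g) (Pa a d g) ≤ wB2 Q' g (Ea a d g) (Pa a d g) c₁ c₂ ∧
      wB2 Q' g (Ea a d g) (Pa a d g) c₁ c₂ ≤ 2 * wA2 Q' g (Ea a d g) (Pa a d g)) :
    ∑ p ∈ Splus a mlo M' nlo N' L d g t v,
        (rhoJ (Pa a d g) R (Jfix Q' g (Ea a d g) (Pa a d g) c₁ c₂) (Ktil a d g t p) : ℝ) ≤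
      Real.sqrt ((σ 0 (Amax a) : ℝ) ^ 2 * (C ^ 3 * (((L : ℝ) + 2) * ((M' : ℝ) + 2) * ((N' : ℝ) + 2)) * Real.log Y ^ 24)) *
      Real.sqrt (rhoFactor CS Q' g (Ea a d g) (Pa a d g) c₁ c₂ S R C Y) := by
  set E := Ea a d g with hE
  set P := Pa a d g with hP
  set A₁ := wA1 Q' g E P c₁ c₂ with hA₁
  set B₁ := wB1 Q' g E P with hB₁
  set A₂ := wA2 Q' g E P with hA₂
  set B₂ := wB2 Q' g E P c₁ c₂ with hB₂
  set Q₀ := min A₁ A₂ with hQ₀def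
  set X := max B₁ B₂ with hX
  have hP0 : 0 < P := Pa_pos a d g
  -- Cauchy–Schwarz
  have hcs := sum_rhoJ_comp_le (Splus a mlo M' nlo N' L d g t v) (Ktil a d g t) (H := S)
    (fun p hp => Ktil_le_of_mem_Splus ha t v hS hp) P R (Jfix Q' g E P c₁ c₂)
  refine hcs.trans (mul_le_mul ?_ ?_ (Real.sqrt_nonneg _) (Real.sqrt_nonneg _))
  · -- multiplicities
    apply Real.sqrt_le_sqrt
    refine (sum_valMult_Ktil_le ha hd hgΘ v ht).trans ?_
    obtain ⟨-, -, hL2, -⟩ := hC L Y hLY hY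
    obtain ⟨-, -, hM2, -⟩ := hC M' Y hMY hY
    obtain ⟨-, -, hN2, -⟩ := hC N' Y hNY hY
    have h0L : 0 ≤ ∑ l ∈ Icc 1 L, (σ 0 l : ℝ) ^ 2 := Finset.sum_nonneg fun _ _ => by positivity
    have h0M : 0 ≤ ∑ m ∈ Icc 1 M', (σ 0 m : ℝ) ^ 2 := Finset.sum_nonneg fun _ _ => by positivity
    have h0N : 0 ≤ ∑ n ∈ Icc 1 N', (σ 0 n : ℝ) ^ 2 := Finset.sum_nonneg fun _ _ => by positivity
    have hlogY : 0 ≤ Real.log Y := Real.log_nonneg (by exact_mod_cast (by omega : 1 ≤ Y))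
    have hprod : (∑ l ∈ Icc 1 L, (σ 0 l : ℝ) ^ 2) * (∑ m ∈ Icc 1 M', (σ 0 m : ℝ) ^ 2) * (∑ n ∈ Icc 1 N', (σ 0 n : ℝ) ^ 2) ≤
        (C * ((L : ℝ) + 2) * Real.log Y ^ 8) * (C * ((M' : ℝ) + 2) * Real.log Y ^ 8) * (C * ((N' : ℝ) + 2) * Real.log Y ^ 8) :=
      mul_le_mul (mul_le_mul hL2 hM2 h0M (by positivity)) hN2 h0N (by positivity)
    calc (σ 0 (Amax a) : ℝ) ^ 2 * ((∑ l ∈ Icc 1 L, (σ 0 l : ℝ) ^ 2) * (∑ m ∈ Icc 1 M', (σ 0 m : ℝ) ^ 2) *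
          (∑ n ∈ Icc 1 N', (σ 0 n : ℝ) ^ 2))
        ≤ (σ 0 (Amax a) : ℝ) ^ 2 * ((C * ((L : ℝ) + 2) * Real.log Y ^ 8) * (C * ((M' : ℝ) + 2) * Real.log Y ^ 8) *
            (C * ((N' : ℝ) + 2) * Real.log Y ^ 8)) := mul_le_mul_of_nonneg_left hprod (by positivity)
      _ = _ := by ring
  · -- the second moment
    apply Real.sqrt_le_sqrt
    have h2nd := sum_rhoJ_sq_le_explicit (P := P) hP0 (R := R) hR (A₁ := A₁) (B₁ := B₁) (A₂ := A₂) (B₂ := B₂)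
      (Q₀ := Q₀) (X := X) hQ₀ (min_le_left _ _) (min_le_right _ _) (le_max_left _ _) (le_max_right _ _) S
    rw [Jfix_eq]
    refine h2nd.trans ?_
    have hlogY : 0 ≤ Real.log Y := Real.log_nonneg (by exact_mod_cast (by omega : 1 ≤ Y))
    have hlogR : 0 ≤ 1 + Real.log R := by
      have := Real.log_nonneg (show (1 : ℝ) ≤ R by exact_mod_cast hR); linarith
    obtain ⟨-, -, -, hR2⟩ := hC R Y hRY hY
    have hJsum : ∑ q ∈ Ioc A₁ B₁ ∪ Ioc A₂ B₂, (σ 0 q : ℝ) ^ 2 / q ≤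
        (CS * max ((B₁ : ℝ) - A₁) (Real.sqrt A₁) * Real.log A₁ ^ 3 +
          CS * max ((B₂ : ℝ) - A₂) (Real.sqrt A₂) * Real.log A₂ ^ 3) / Q₀ := by
      refine (sum_sigma_zero_sq_div_le hQ₀ (min_le_left _ _) (min_le_right _ _)).trans ?_
      have hQ₀' : (0 : ℝ) < Q₀ := by exact_mod_cast hQ₀
      apply div_le_div_of_nonneg_right _ hQ₀'.le
      exact add_le_add (hShiu A₁ B₁ hw1.1 hw1.2.1 hw1.2.2) (hShiu A₂ B₂ hw2.1 hw2.2.1 hw2.2.2)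
    have hJ0 : 0 ≤ ∑ q ∈ Ioc A₁ B₁ ∪ Ioc A₂ B₂, (σ 0 q : ℝ) ^ 2 / q := Finset.sum_nonneg fun _ _ => by positivity
    have hfac0 : 0 ≤ (S : ℝ) * ((1 + Real.log R) * (((B₁ - A₁ : ℕ) : ℝ) + ((B₂ - A₂ : ℕ) : ℝ) + 2 * X) / ((P : ℝ) * Q₀)) := by
      positivity
    unfold rhoFactor
    apply mul_le_mul_of_nonneg_left _ hfac0
    exact mul_le_mul hR2 hJsum hJ0 (by positivity)

/-! ### Short sums of `1/φ` -/

/-- **`∑_{U < s ≤ V} 1/φ(s) ≤ Φ(V) (log(V/U) + 22/U)`** for `1 ≤ U ≤ V ≤ 3U` (the window estimate of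
`…SwitchHarmonic` with `r = k = 1`). [folklore] -/
theorem sum_inv_totient_Ioc_le {U V : ℕ} (hU : 1 ≤ U) (hUV : U ≤ V) (hV3 : V ≤ 3 * U) :
    ∑ s ∈ Ioc U V, (1 : ℝ) / Nat.totient s ≤ totInvSum V * (Real.log ((V : ℝ) / U) + 22 / U) := by
  have hwin : ∑ s ∈ Ioc U V, (1 : ℝ) / Nat.totient s = phiWin 1 1 U V := by
    unfold phiWin
    rw [Finset.filter_true_of_mem (fun n _ => Nat.coprime_one_right n)]
    simp only [one_mul]
  rw [hwin]
  have h := abs_phiWin_sub_le (r := 1) (k := 1) Nat.one_pos one_ne_zero hU hUV hV3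
  rw [Nat.totient_one, ArithmeticFunction.sigma_zero_apply, Nat.divisors_one, Finset.card_singleton] at h
  simp only [Nat.cast_one, div_one, one_mul, mul_one] at h
  have h1 := (abs_le.1 h).2
  have hU0 : (0 : ℝ) < U := by exact_mod_cast hU
  have hlog : 0 ≤ Real.log ((V : ℝ) / U) := by
    apply Real.log_nonneg
    rw [le_div_iff₀ hU0, one_mul]; exact_mod_cast hUV
  have hsig := sig1_le_totInvSum 1 1 V
  have hsig0 := sig1_nonneg 1 1 V
  have hΦ := totInvSum_nonneg V
  calc phiWin 1 1 U V ≤ Real.log ((V : ℝ) / U) * sig1 1 1 V + 22 * totInvSum V / U := by linarith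
    _ ≤ Real.log ((V : ℝ) / U) * totInvSum V + 22 * totInvSum V / U := by
        gcongr
    _ = totInvSum V * (Real.log ((V : ℝ) / U) + 22 / U) := by ring

/-- The trivial bound `∑_{s ∈ I} 1/φ(s) ≤ |I|`. [folklore] -/
theorem sum_inv_totient_le_card (I : Finset ℕ) : ∑ s ∈ I, (1 : ℝ) / Nat.totient s ≤ I.card := by
  calc ∑ s ∈ I, (1 : ℝ) / Nat.totient s ≤ ∑ _s ∈ I, (1 : ℝ) := by
        refine Finset.sum_le_sum fun s _ => ?_
        rcases Nat.eq_zero_or_pos (Nat.totient s) with h | h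
        · rw [h]; simp
        · rw [div_le_one (by exact_mod_cast h)]; exact_mod_cast h
    _ = I.card := by simp

/-! ### The `s'`-windows of one cell -/

/-- Elementary: `1/(1 − y) ≤ 1 + 2y` for `0 ≤ y ≤ 1/2`. [folklore] -/
theorem one_div_one_sub_le {y : ℝ} (hy0 : 0 ≤ y) (hy : y ≤ 1 / 2) : 1 / (1 - y) ≤ 1 + 2 * y := by
  rw [div_le_iff₀ (by linarith)]
  nlinarith

set_option maxHeartbeats 800000 in
/-- **One window of `1/φ`** in the shape used for the ambiguous ranges: for reals `u ≤ U` (`U ≥ 1` a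
natural), `V ≤ v`, `v ≤ 3u`, `u > 0`, `log(v/u) ≥ 0`: `∑_{U < s ≤ V} 1/φ(s) ≤ Φ(V) (log(v/u) + 22/u)`. [folklore] -/
theorem sum_inv_totient_Ioc_le_real {U V : ℕ} {u v : ℝ} (hU : 1 ≤ U) (hu0 : 0 < u) (huU : u ≤ U)
    (hVv : (V : ℝ) ≤ v) (hv : v ≤ 3 * u) (hlog : 0 ≤ Real.log (v / u)) :
    ∑ s ∈ Ioc U V, (1 : ℝ) / Nat.totient s ≤ totInvSum V * (Real.log (v / u) + 22 / u) := by
  have hΦ := totInvSum_nonneg V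
  rcases le_or_gt V U with hVU | hUV
  · -- empty window
    have : Ioc U V = ∅ := Finset.Ioc_eq_empty (by omega)
    rw [this, Finset.sum_empty]
    exact mul_nonneg hΦ (by linarith [hlog, show (0:ℝ) ≤ 22 / u by positivity])
  · have hUV' : U ≤ V := hUV.le
    have hU0 : (0 : ℝ) < U := by exact_mod_cast hU
    have hV3 : V ≤ 3 * U := by
      have : (V : ℝ) ≤ 3 * U := hVv.trans (hv.trans (by linarith))
      exact_mod_cast this
    refine (sum_inv_totient_Ioc_le hU hUV' hV3).trans ?_
    apply mul_le_mul_of_nonneg_left _ hΦ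
    have hV0 : (0 : ℝ) < V := by exact_mod_cast (show 0 < V by omega)
    have h1 : Real.log ((V : ℝ) / U) ≤ Real.log (v / u) := by
      apply Real.log_le_log (by positivity)
      rw [div_le_div_iff₀ hU0 hu0]
      nlinarith
    have h2 : (22 : ℝ) / U ≤ 22 / u := div_le_div_of_nonneg_left (by norm_num) hu0 huU
    linarith

/-- `Φ(V) ≥ 1` for `V ≥ 1`. [folklore] -/
theorem one_le_totInvSum {V : ℕ} (hV : 1 ≤ V) : 1 ≤ totInvSum V := by
  unfold totInvSum
  have h := Finset.single_le_sum (f := fun e : ℕ => (1 : ℝ) / Nat.totient e) (fun _ _ => by positivity)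
    (Finset.mem_Icc.2 ⟨le_refl 1, hV⟩)
  simpa using h

set_option maxHeartbeats 1600000 in
/-- **The two ambiguous windows of one cell**: with `D₋ ≤ D₊`, `1 ≤ K₋ ≤ K₊`, the spread
`D₊ K₊ c₁ ≤ D₋ K₋ c₂` and `c₁ ≤ c₂ ≤ 2c₁`,
`∑_{⌈K₋/(2D₊)⌉ ≤ s ≤ ⌈K₊/(2D₋)⌉−1} 1/φ(s) + ∑_{(K₋−1)/D₊ < s ≤ (K₊−1)/D₋} 1/φ(s) ≤ Φ(K₊) (2 log(c₂/c₁) + 200 D₊/K₋)`.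
[folklore] -/
theorem windows_le {Km Kp Dm Dp c₁ c₂ : ℕ} (hKm : 1 ≤ Km) (hKmp : Km ≤ Kp) (hDm : 0 < Dm) (hDmp : Dm ≤ Dp)
    (hc₁ : 0 < c₁) (hc₁₂ : c₁ ≤ c₂) (hc₂ : c₂ ≤ 2 * c₁) (hspread : Dp * Kp * c₁ ≤ Dm * Km * c₂) :
    (∑ s ∈ Icc ((Km + 2 * Dp - 1) / (2 * Dp)) ((Kp + 2 * Dm - 1) / (2 * Dm) - 1), (1 : ℝ) / Nat.totient s) +
      ∑ s ∈ Ioc ((Km - 1) / Dp) ((Kp - 1) / Dm), (1 : ℝ) / Nat.totient s ≤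
      totInvSum Kp * (2 * Real.log ((c₂ : ℝ) / c₁) + 200 * ((Dp : ℝ) / Km)) := by
  have hDp : 0 < Dp := lt_of_lt_of_le hDm hDmp
  have hKp : 1 ≤ Kp := hKm.trans hKmp
  -- real versions
  have hKm' : (1 : ℝ) ≤ Km := by exact_mod_cast hKm
  have hKmp' : (Km : ℝ) ≤ Kp := by exact_mod_cast hKmp
  have hDm' : (0 : ℝ) < Dm := by exact_mod_cast hDm
  have hDp' : (0 : ℝ) < Dp := by exact_mod_cast hDp
  have hDmp' : (Dm : ℝ) ≤ Dp := by exact_mod_cast hDmp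
  have hc₁' : (0 : ℝ) < c₁ := by exact_mod_cast hc₁
  have hc₁₂' : (c₁ : ℝ) ≤ c₂ := by exact_mod_cast hc₁₂
  have hc₂' : (c₂ : ℝ) ≤ 2 * c₁ := by exact_mod_cast hc₂
  have hsp' : (Dp : ℝ) * Kp * c₁ ≤ (Dm : ℝ) * Km * c₂ := by exact_mod_cast hspread
  have hratio : (Kp : ℝ) * Dp / ((Km : ℝ) * Dm) ≤ (c₂ : ℝ) / c₁ := by
    rw [div_le_div_iff₀ (by positivity) hc₁']; nlinarith
  have hratio2 : (Kp : ℝ) / Dm ≤ 2 * ((Km : ℝ) / Dp) := by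
    rw [mul_div_assoc', div_le_div_iff₀ hDm' hDp']
    have h1 : (Dm : ℝ) * Km * c₂ ≤ Dm * Km * (2 * c₁) := mul_le_mul_of_nonneg_left hc₂' (by positivity)
    have h2 : (Kp : ℝ) * Dp * c₁ ≤ (2 * Km * Dm) * c₁ := by linarith
    exact le_of_mul_le_mul_right h2 hc₁'
  have hlogc : 0 ≤ Real.log ((c₂ : ℝ) / c₁) := Real.log_nonneg (by rw [le_div_iff₀ hc₁']; linarith)
  have hΦ1 : 1 ≤ totInvSum Kp := one_le_totInvSum hKp
  have hΦ0 : 0 ≤ totInvSum Kp := by linarith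
  -- the first window as an `Ioc`
  have hSlo1 : 1 ≤ (Km + 2 * Dp - 1) / (2 * Dp) := by
    rw [Nat.le_div_iff_mul_le (by positivity)]; omega
  have hIcc : Icc ((Km + 2 * Dp - 1) / (2 * Dp)) ((Kp + 2 * Dm - 1) / (2 * Dm) - 1) =
      Ioc ((Km + 2 * Dp - 1) / (2 * Dp) - 1) ((Kp + 2 * Dm - 1) / (2 * Dm) - 1) := by
    ext s; simp only [Finset.mem_Icc, Finset.mem_Ioc]; omega
  rw [hIcc]
  by_cases hbig : 8 * Dp ≤ Km
  · -- big cells: the window lemma twice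
    have hbig' : 8 * (Dp : ℝ) ≤ Km := by exact_mod_cast hbig
    have hy : 2 * (Dp : ℝ) / Km ≤ 1 / 4 := by
      rw [div_le_div_iff₀ (by positivity) (by norm_num)]; linarith
    have hy0 : 0 ≤ 2 * (Dp : ℝ) / Km := by positivity
    -- window 1
    set U₁ := (Km + 2 * Dp - 1) / (2 * Dp) - 1 with hU₁
    set V₁ := (Kp + 2 * Dm - 1) / (2 * Dm) - 1 with hV₁
    have hu₁ : (Km : ℝ) / (2 * Dp) - 1 ≤ U₁ := by
      have h1 : Km ≤ (Km + 2 * Dp - 1) / (2 * Dp) * (2 * Dp) := le_ceilDiv_mul (by positivity)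
      have h2 : ((Km : ℕ) : ℝ) ≤ (((Km + 2 * Dp - 1) / (2 * Dp) : ℕ) : ℝ) * (2 * Dp) := by exact_mod_cast h1
      have h3 : ((U₁ : ℕ) : ℝ) = (((Km + 2 * Dp - 1) / (2 * Dp) : ℕ) : ℝ) - 1 := by
        rw [hU₁, Nat.cast_sub hSlo1]; simp
      rw [h3, div_sub_one (by positivity), div_le_iff₀ (by positivity)]
      nlinarith
    have hu₁pos : 0 < (Km : ℝ) / (2 * Dp) - 1 := by
      rw [sub_pos, lt_div_iff₀ (by positivity)]; linarith
    have hU₁1 : 1 ≤ U₁ := by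
      have : (1 : ℝ) ≤ U₁ := by
        have : (1 : ℝ) ≤ (Km : ℝ) / (2 * Dp) - 1 := by
          rw [le_sub_iff_add_le, le_div_iff₀ (by positivity)]; linarith
        linarith
      exact_mod_cast this
    have hv₁ : (V₁ : ℝ) ≤ (Kp : ℝ) / (2 * Dm) := by
      have h1 : ((Kp + 2 * Dm - 1) / (2 * Dm) - 1) * (2 * Dm) < Kp := ceilDiv_pred_mul_lt (by omega) (by positivity)
      have h2 : ((V₁ : ℕ) : ℝ) * (2 * Dm) < Kp := by rw [hV₁]; exact_mod_cast h1
      rw [le_div_iff₀ (by positivity)]; linarith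
    have hvu₁ : (Kp : ℝ) / (2 * Dm) ≤ 3 * ((Km : ℝ) / (2 * Dp) - 1) := by
      have e1 : (Kp : ℝ) / (2 * Dm) = ((Kp : ℝ) / Dm) / 2 := by field_simp
      have e2 : (Km : ℝ) / (2 * Dp) = ((Km : ℝ) / Dp) / 2 := by field_simp
      rw [e1, e2]
      have h3 : 6 ≤ (Km : ℝ) / Dp := by rw [le_div_iff₀ hDp']; linarith
      linarith
    have hlog₁ : 0 ≤ Real.log ((Kp : ℝ) / (2 * Dm) / ((Km : ℝ) / (2 * Dp) - 1)) := by
      apply Real.log_nonneg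
      rw [le_div_iff₀ hu₁pos, one_mul]
      have : (Km : ℝ) / (2 * Dp) ≤ (Kp : ℝ) / (2 * Dm) := by
        rw [div_le_div_iff₀ (by positivity) (by positivity)]; nlinarith
      linarith
    have hW1 := sum_inv_totient_Ioc_le_real (U := U₁) (V := V₁) hU₁1 hu₁pos hu₁ hv₁ hvu₁ hlog₁
    -- evaluate `log(v/u) ≤ log(c₂/c₁) + 4 D₊/K₋` and `22/u ≤ 88 D₊/K₋`
    have hlogv₁ : Real.log ((Kp : ℝ) / (2 * Dm) / ((Km : ℝ) / (2 * Dp) - 1)) ≤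
        Real.log ((c₂ : ℝ) / c₁) + 4 * ((Dp : ℝ) / Km) := by
      have e : (Kp : ℝ) / (2 * Dm) / ((Km : ℝ) / (2 * Dp) - 1) =
          ((Kp : ℝ) * Dp / ((Km : ℝ) * Dm)) * (1 / (1 - 2 * (Dp : ℝ) / Km)) := by
        field_simp
      rw [e, Real.log_mul (by positivity) (by
        have : 0 < 1 - 2 * (Dp : ℝ) / Km := by linarith
        positivity)]
      have h1 : Real.log ((Kp : ℝ) * Dp / ((Km : ℝ) * Dm)) ≤ Real.log ((c₂ : ℝ) / c₁) :=
        Real.log_le_log (by positivity) hratio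
      have h2 : Real.log (1 / (1 - 2 * (Dp : ℝ) / Km)) ≤ 4 * ((Dp : ℝ) / Km) := by
        have h3 := one_div_one_sub_le hy0 (by linarith)
        have h4 : 0 < 1 / (1 - 2 * (Dp : ℝ) / Km) := by
          have : 0 < 1 - 2 * (Dp : ℝ) / Km := by linarith
          positivity
        calc Real.log (1 / (1 - 2 * (Dp : ℝ) / Km)) ≤ 1 / (1 - 2 * (Dp : ℝ) / Km) - 1 := Real.log_le_sub_one_of_pos h4
          _ ≤ 2 * (2 * (Dp : ℝ) / Km) := by linarith
          _ = 4 * ((Dp : ℝ) / Km) := by ring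
      linarith
    have h22₁ : 22 / ((Km : ℝ) / (2 * Dp) - 1) ≤ 88 * ((Dp : ℝ) / Km) := by
      have h1 : (Km : ℝ) / (4 * Dp) ≤ (Km : ℝ) / (2 * Dp) - 1 := by
        rw [div_le_iff₀ (by positivity)]
        have : ((Km : ℝ) / (2 * Dp) - 1) * (4 * Dp) = 2 * Km - 4 * Dp := by field_simp; ring
        rw [this]; linarith
      calc 22 / ((Km : ℝ) / (2 * Dp) - 1) ≤ 22 / ((Km : ℝ) / (4 * Dp)) :=
            div_le_div_of_nonneg_left (by norm_num) (by positivity) h1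
        _ = 88 * ((Dp : ℝ) / Km) := by field_simp; ring
    have hΦV₁ : totInvSum V₁ ≤ totInvSum Kp := by
      apply totInvSum_mono
      have : (V₁ : ℝ) ≤ Kp := hv₁.trans (by
        rw [div_le_iff₀ (by positivity)]
        have h1 : (1 : ℝ) ≤ Dm := by exact_mod_cast hDm
        nlinarith)
      exact_mod_cast this
    -- window 2
    set U₂ := (Km - 1) / Dp with hU₂
    set V₂ := (Kp - 1) / Dm with hV₂
    have hu₂ : (Km : ℝ) / Dp - 2 ≤ U₂ := by
      have h1 : Km - 1 < (Km - 1) / Dp * Dp + Dp := Nat.lt_div_mul_add hDp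
      have h2 : ((Km - 1 : ℕ) : ℝ) < ((U₂ : ℕ) : ℝ) * Dp + Dp := by rw [hU₂]; exact_mod_cast h1
      rw [Nat.cast_sub hKm] at h2
      push_cast at h2
      have hDp1 : (1 : ℝ) ≤ Dp := by exact_mod_cast hDp
      rw [sub_le_iff_le_add, div_le_iff₀ hDp']
      nlinarith
    have hu₂pos : 0 < (Km : ℝ) / Dp - 2 := by
      rw [sub_pos, lt_div_iff₀ hDp']; linarith
    have hU₂1 : 1 ≤ U₂ := by
      have : (1 : ℝ) ≤ U₂ := by
        have : (1 : ℝ) ≤ (Km : ℝ) / Dp - 2 := by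
          rw [le_sub_iff_add_le, le_div_iff₀ hDp']; linarith
        linarith
      exact_mod_cast this
    have hv₂ : (V₂ : ℝ) ≤ (Kp : ℝ) / Dm := by
      have h1 : (Kp - 1) / Dm * Dm ≤ Kp - 1 := Nat.div_mul_le_self _ _
      have h2 : ((V₂ : ℕ) : ℝ) * Dm ≤ ((Kp - 1 : ℕ) : ℝ) := by rw [hV₂]; exact_mod_cast h1
      rw [Nat.cast_sub hKp] at h2
      push_cast at h2
      rw [le_div_iff₀ hDm']; linarith
    have hvu₂ : (Kp : ℝ) / Dm ≤ 3 * ((Km : ℝ) / Dp - 2) := by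
      have h3 : 6 ≤ (Km : ℝ) / Dp := by rw [le_div_iff₀ hDp']; linarith
      linarith
    have hlog₂ : 0 ≤ Real.log ((Kp : ℝ) / Dm / ((Km : ℝ) / Dp - 2)) := by
      apply Real.log_nonneg
      rw [le_div_iff₀ hu₂pos, one_mul]
      have : (Km : ℝ) / Dp ≤ (Kp : ℝ) / Dm := by
        rw [div_le_div_iff₀ hDp' hDm']; nlinarith
      linarith
    have hW2 := sum_inv_totient_Ioc_le_real (U := U₂) (V := V₂) hU₂1 hu₂pos hu₂ hv₂ hvu₂ hlog₂
    have hlogv₂ : Real.log ((Kp : ℝ) / Dm / ((Km : ℝ) / Dp - 2)) ≤ Real.log ((c₂ : ℝ) / c₁) + 4 * ((Dp : ℝ) / Km) := by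
      have e : (Kp : ℝ) / Dm / ((Km : ℝ) / Dp - 2) =
          ((Kp : ℝ) * Dp / ((Km : ℝ) * Dm)) * (1 / (1 - 2 * (Dp : ℝ) / Km)) := by
        field_simp
      rw [e, Real.log_mul (by positivity) (by
        have : 0 < 1 - 2 * (Dp : ℝ) / Km := by linarith
        positivity)]
      have h1 : Real.log ((Kp : ℝ) * Dp / ((Km : ℝ) * Dm)) ≤ Real.log ((c₂ : ℝ) / c₁) :=
        Real.log_le_log (by positivity) hratio
      have h2 : Real.log (1 / (1 - 2 * (Dp : ℝ) / Km)) ≤ 4 * ((Dp : ℝ) / Km) := by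
        have h3 := one_div_one_sub_le hy0 (by linarith)
        have h4 : 0 < 1 / (1 - 2 * (Dp : ℝ) / Km) := by
          have : 0 < 1 - 2 * (Dp : ℝ) / Km := by linarith
          positivity
        calc Real.log (1 / (1 - 2 * (Dp : ℝ) / Km)) ≤ 1 / (1 - 2 * (Dp : ℝ) / Km) - 1 := Real.log_le_sub_one_of_pos h4
          _ ≤ 2 * (2 * (Dp : ℝ) / Km) := by linarith
          _ = 4 * ((Dp : ℝ) / Km) := by ring
      linarith
    have h22₂ : 22 / ((Km : ℝ) / Dp - 2) ≤ 44 * ((Dp : ℝ) / Km) := by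
      have h1 : (Km : ℝ) / (2 * Dp) ≤ (Km : ℝ) / Dp - 2 := by
        rw [div_le_iff₀ (by positivity)]
        have : ((Km : ℝ) / Dp - 2) * (2 * Dp) = 2 * Km - 4 * Dp := by field_simp; ring
        rw [this]; linarith
      calc 22 / ((Km : ℝ) / Dp - 2) ≤ 22 / ((Km : ℝ) / (2 * Dp)) :=
            div_le_div_of_nonneg_left (by norm_num) (by positivity) h1
        _ = 44 * ((Dp : ℝ) / Km) := by field_simp; ring
    have hΦV₂ : totInvSum V₂ ≤ totInvSum Kp := by
      apply totInvSum_mono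
      have : (V₂ : ℝ) ≤ Kp := hv₂.trans (by
        rw [div_le_iff₀ hDm']
        have : (1 : ℝ) ≤ Dm := by exact_mod_cast hDm
        nlinarith)
      exact_mod_cast this
    -- combine
    have hDK : 0 ≤ (Dp : ℝ) / Km := by positivity
    have hA : ∑ s ∈ Ioc U₁ V₁, (1 : ℝ) / Nat.totient s ≤ totInvSum Kp * (Real.log ((c₂ : ℝ) / c₁) + 92 * ((Dp : ℝ) / Km)) := by
      refine hW1.trans ?_
      calc totInvSum V₁ * (Real.log ((Kp : ℝ) / (2 * Dm) / ((Km : ℝ) / (2 * Dp) - 1)) + 22 / ((Km : ℝ) / (2 * Dp) - 1))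
          ≤ totInvSum Kp * (Real.log ((Kp : ℝ) / (2 * Dm) / ((Km : ℝ) / (2 * Dp) - 1)) + 22 / ((Km : ℝ) / (2 * Dp) - 1)) :=
            mul_le_mul_of_nonneg_right hΦV₁ (by positivity)
        _ ≤ totInvSum Kp * (Real.log ((c₂ : ℝ) / c₁) + 92 * ((Dp : ℝ) / Km)) := by
            apply mul_le_mul_of_nonneg_left _ hΦ0; linarith
    have hB : ∑ s ∈ Ioc U₂ V₂, (1 : ℝ) / Nat.totient s ≤ totInvSum Kp * (Real.log ((c₂ : ℝ) / c₁) + 48 * ((Dp : ℝ) / Km)) := by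
      refine hW2.trans ?_
      calc totInvSum V₂ * (Real.log ((Kp : ℝ) / Dm / ((Km : ℝ) / Dp - 2)) + 22 / ((Km : ℝ) / Dp - 2))
          ≤ totInvSum Kp * (Real.log ((Kp : ℝ) / Dm / ((Km : ℝ) / Dp - 2)) + 22 / ((Km : ℝ) / Dp - 2)) :=
            mul_le_mul_of_nonneg_right hΦV₂ (by positivity)
        _ ≤ totInvSum Kp * (Real.log ((c₂ : ℝ) / c₁) + 48 * ((Dp : ℝ) / Km)) := by
            apply mul_le_mul_of_nonneg_left _ hΦ0; linarith
    calc ∑ s ∈ Ioc U₁ V₁, (1 : ℝ) / Nat.totient s + ∑ s ∈ Ioc U₂ V₂, (1 : ℝ) / Nat.totient s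
        ≤ totInvSum Kp * (Real.log ((c₂ : ℝ) / c₁) + 92 * ((Dp : ℝ) / Km)) +
          totInvSum Kp * (Real.log ((c₂ : ℝ) / c₁) + 48 * ((Dp : ℝ) / Km)) := add_le_add hA hB
      _ ≤ totInvSum Kp * (2 * Real.log ((c₂ : ℝ) / c₁) + 200 * ((Dp : ℝ) / Km)) := by nlinarith
  · -- small cells: the trivial bound
    push Not at hbig
    have hsmall : (Km : ℝ) < 8 * Dp := by exact_mod_cast hbig
    have hc1 := sum_inv_totient_le_card (Ioc ((Km + 2 * Dp - 1) / (2 * Dp) - 1) ((Kp + 2 * Dm - 1) / (2 * Dm) - 1))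
    have hc2 := sum_inv_totient_le_card (Ioc ((Km - 1) / Dp) ((Kp - 1) / Dm))
    rw [Nat.card_Ioc] at hc1 hc2
    -- the cardinalities are `≤ S₁` and `≤ Shi`
    have hS₁ : ((((Kp + 2 * Dm - 1) / (2 * Dm) - 1) - ((Km + 2 * Dp - 1) / (2 * Dp) - 1) : ℕ) : ℝ) ≤
        (Kp : ℝ) / (2 * Dm) + 1 := by
      have h1 : ((Kp + 2 * Dm - 1) / (2 * Dm) - 1) - ((Km + 2 * Dp - 1) / (2 * Dp) - 1) ≤ (Kp + 2 * Dm - 1) / (2 * Dm) :=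
        (Nat.sub_le _ _).trans (Nat.sub_le _ _)
      have h2 : (Kp + 2 * Dm - 1) / (2 * Dm) * (2 * Dm) ≤ Kp + 2 * Dm - 1 := Nat.div_mul_le_self _ _
      have h3 : ((((Kp + 2 * Dm - 1) / (2 * Dm) : ℕ)) : ℝ) * (2 * Dm) ≤ ((Kp + 2 * Dm - 1 : ℕ) : ℝ) := by exact_mod_cast h2
      have h4 : ((((Kp + 2 * Dm - 1) / (2 * Dm) - 1) - ((Km + 2 * Dp - 1) / (2 * Dp) - 1) : ℕ) : ℝ) ≤
          ((((Kp + 2 * Dm - 1) / (2 * Dm) : ℕ)) : ℝ) := by exact_mod_cast h1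
      have h5 : ((Kp + 2 * Dm - 1 : ℕ) : ℝ) ≤ (Kp : ℝ) + 2 * Dm := by
        have : Kp + 2 * Dm - 1 ≤ Kp + 2 * Dm := Nat.sub_le _ _
        exact_mod_cast this
      have h6 : ((((Kp + 2 * Dm - 1) / (2 * Dm) : ℕ)) : ℝ) ≤ (Kp : ℝ) / (2 * Dm) + 1 := by
        rw [div_add_one (by positivity), le_div_iff₀ (by positivity)]; linarith
      linarith
    have hShi : ((((Kp - 1) / Dm - (Km - 1) / Dp) : ℕ) : ℝ) ≤ (Kp : ℝ) / Dm := by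
      have h1 : (Kp - 1) / Dm - (Km - 1) / Dp ≤ (Kp - 1) / Dm := Nat.sub_le _ _
      have h2 : (Kp - 1) / Dm * Dm ≤ Kp - 1 := Nat.div_mul_le_self _ _
      have h3 : ((((Kp - 1) / Dm : ℕ)) : ℝ) * Dm ≤ ((Kp - 1 : ℕ) : ℝ) := by exact_mod_cast h2
      rw [Nat.cast_sub hKp] at h3
      have h4 : ((((Kp - 1) / Dm - (Km - 1) / Dp) : ℕ) : ℝ) ≤ ((((Kp - 1) / Dm : ℕ)) : ℝ) := by exact_mod_cast h1
      have h5 : ((((Kp - 1) / Dm : ℕ)) : ℝ) ≤ (Kp : ℝ) / Dm := by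
        rw [le_div_iff₀ hDm']; push_cast at h3; linarith
      linarith
    have hKD : (Kp : ℝ) / Dm < 16 := by
      have : (Km : ℝ) / Dp < 8 := by rw [div_lt_iff₀ hDp']; linarith
      linarith
    have hKD2 : (Kp : ℝ) / (2 * Dm) < 8 := by
      have : (Kp : ℝ) / (2 * Dm) = ((Kp : ℝ) / Dm) / 2 := by field_simp
      rw [this]; linarith
    have hR : 25 ≤ totInvSum Kp * (2 * Real.log ((c₂ : ℝ) / c₁) + 200 * ((Dp : ℝ) / Km)) := by
      have h1 : (25 : ℝ) < 200 * ((Dp : ℝ) / Km) := by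
        have : (1 : ℝ) / 8 < (Dp : ℝ) / Km := by
          rw [div_lt_div_iff₀ (by norm_num) (by positivity)]; linarith
        linarith
      have h2 : 2 * Real.log ((c₂ : ℝ) / c₁) + 200 * ((Dp : ℝ) / Km) ≥ 25 := by linarith
      nlinarith
    linarith

/-! ### The ambiguous `B`-part: per-cell bounds -/

/-- `K₋ ≤ K₊` for a nonempty cell. [folklore] -/
theorem KmOf_le_KpOf {a : ℤ} {mlo M' nlo N' L : ℕ} {t : ℤ × ℕ × ℕ} {β : ℝ} {κ i j l m n : ℕ}
    (hl : l ∈ Ioc (bp 0 L β κ) (bp 0 L β (κ + 1)))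
    (hm : m ∈ Ioc (bpM mlo M' t β i) (bpM mlo M' t β (i + 1)))
    (hn : n ∈ Ioc (bpN nlo N' t β j) (bpN nlo N' t β (j + 1))) :
    KmOf a mlo M' nlo N' L t β κ i j ≤ KpOf a mlo M' nlo N' L t β κ i j := by
  rw [Finset.mem_Ioc] at hl hm hn
  unfold KmOf KpOf cellK
  apply Int.toNat_le_toNat
  have h : (bp 0 L β κ + 1) * t.2.1 * t.2.2 * (bpM mlo M' t β i + 1) * (bpN nlo N' t β j + 1) ≤
      bp 0 L β (κ + 1) * t.2.1 * t.2.2 * bpM mlo M' t β (i + 1) * bpN nlo N' t β (j + 1) :=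
    Nat.mul_le_mul (Nat.mul_le_mul (Nat.mul_le_mul_right _ (Nat.mul_le_mul_right _ (by omega))) (by omega)) (by omega)
  have h' : (((bp 0 L β κ + 1) * t.2.1 * t.2.2 * (bpM mlo M' t β i + 1) * (bpN nlo N' t β j + 1) : ℕ) : ℤ) ≤
      ((bp 0 L β (κ + 1) * t.2.1 * t.2.2 * bpM mlo M' t β (i + 1) * bpN nlo N' t β (j + 1) : ℕ) : ℤ) := by
    exact_mod_cast h
  linarith

/-- `K₊ ≤ L M' N' + |a|`. [folklore] -/
theorem KpOf_le {a : ℤ} {mlo M' nlo N' L : ℕ} (hmlo : mlo ≤ M') (hnlo : nlo ≤ N') (t : ℤ × ℕ × ℕ) (β : ℝ)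
    (κ i j : ℕ) : KpOf a mlo M' nlo N' L t β κ i j ≤ L * M' * N' + a.natAbs := by
  unfold KpOf cellK
  have h1 : bp 0 L β (κ + 1) ≤ L := by have := (bp_bounds 0 L β (κ + 1)).2; rwa [Nat.zero_max] at this
  have h2 : bpM mlo M' t β (i + 1) ≤ M' / t.2.1 := by
    have := (bp_bounds (mlo / t.2.1) (M' / t.2.1) β (i + 1)).2
    rwa [max_eq_right (Nat.div_le_div_right hmlo)] at this
  have h3 : bpN nlo N' t β (j + 1) ≤ N' / t.2.2 := by
    have := (bp_bounds (nlo / t.2.2) (N' / t.2.2) β (j + 1)).2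
    rwa [max_eq_right (Nat.div_le_div_right hnlo)] at this
  have h4 : bp 0 L β (κ + 1) * t.2.1 * t.2.2 * bpM mlo M' t β (i + 1) * bpN nlo N' t β (j + 1) ≤ L * M' * N' := by
    calc bp 0 L β (κ + 1) * t.2.1 * t.2.2 * bpM mlo M' t β (i + 1) * bpN nlo N' t β (j + 1)
        = bp 0 L β (κ + 1) * (t.2.1 * bpM mlo M' t β (i + 1)) * (t.2.2 * bpN nlo N' t β (j + 1)) := by ring
      _ ≤ L * M' * N' := by
          apply Nat.mul_le_mul (Nat.mul_le_mul h1 _) _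
          · exact (Nat.mul_le_mul_left _ h2).trans (Nat.mul_div_le M' t.2.1)
          · exact (Nat.mul_le_mul_left _ h3).trans (Nat.mul_div_le N' t.2.2)
  have h5 : ((bp 0 L β (κ + 1) * t.2.1 * t.2.2 * bpM mlo M' t β (i + 1) * bpN nlo N' t β (j + 1) : ℕ) : ℤ) ≤
      ((L * M' * N' : ℕ) : ℤ) := by exact_mod_cast h4
  have h6 : -(a : ℤ) ≤ |a| := neg_le_abs a
  have : (((bp 0 L β (κ + 1) * t.2.1 * t.2.2 * bpM mlo M' t β (i + 1) * bpN nlo N' t β (j + 1) : ℕ) : ℤ) - a) ≤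
      ((L * M' * N' + a.natAbs : ℕ) : ℤ) := by push_cast at h5 ⊢; linarith
  exact (Int.toNat_le_toNat this).trans (by simp)

/-- **`1/K₋ ≤ 54/(l m'' n'')`** on a nonempty cell whose lower corner exceeds `4|a|`. [folklore] -/
theorem inv_KmOf_le {a : ℤ} {mlo M' nlo N' L D₀ : ℕ} (hD₀ : 0 < D₀) {t : ℤ × ℕ × ℕ} (hDm : 0 < t.2.1) (hDn : 0 < t.2.2)
    {κ i j l m n : ℕ}
    (hl : l ∈ Ioc (bp 0 L (1 + 1 / (D₀ : ℝ)) κ) (bp 0 L (1 + 1 / (D₀ : ℝ)) (κ + 1)))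
    (hm : m ∈ Ioc (bpM mlo M' t (1 + 1 / (D₀ : ℝ)) i) (bpM mlo M' t (1 + 1 / (D₀ : ℝ)) (i + 1)))
    (hn : n ∈ Ioc (bpN nlo N' t (1 + 1 / (D₀ : ℝ)) j) (bpN nlo N' t (1 + 1 / (D₀ : ℝ)) (j + 1)))
    (hP : 4 * a.natAbs < (bp 0 L (1 + 1 / (D₀ : ℝ)) κ + 1) * t.2.1 * t.2.2 *
      (bpM mlo M' t (1 + 1 / (D₀ : ℝ)) i + 1) * (bpN nlo N' t (1 + 1 / (D₀ : ℝ)) j + 1)) :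
    (1 : ℝ) / KmOf a mlo M' nlo N' L t (1 + 1 / (D₀ : ℝ)) κ i j ≤ 54 / ((l : ℝ) * m * n) := by
  have hδ0 : (0 : ℝ) ≤ 1 / (D₀ : ℝ) := by positivity
  have hδ1 : 1 / (D₀ : ℝ) ≤ 1 := by
    rw [div_le_one (by exact_mod_cast hD₀)]; exact_mod_cast hD₀
  -- lowest elements of the three cells
  have hlc := Finset.mem_Ioc.1 hl
  have hmc := Finset.mem_Ioc.1 hm
  have hnc := Finset.mem_Ioc.1 hn
  have hl0 : bp 0 L (1 + 1 / (D₀ : ℝ)) κ + 1 ∈ Ioc (bp 0 L (1 + 1 / (D₀ : ℝ)) κ) (bp 0 L (1 + 1 / (D₀ : ℝ)) (κ + 1)) := by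
    rw [Finset.mem_Ioc]; omega
  have hm0 : bpM mlo M' t (1 + 1 / (D₀ : ℝ)) i + 1 ∈
      Ioc (bpM mlo M' t (1 + 1 / (D₀ : ℝ)) i) (bpM mlo M' t (1 + 1 / (D₀ : ℝ)) (i + 1)) := by
    rw [Finset.mem_Ioc]; omega
  have hn0 : bpN nlo N' t (1 + 1 / (D₀ : ℝ)) j + 1 ∈
      Ioc (bpN nlo N' t (1 + 1 / (D₀ : ℝ)) j) (bpN nlo N' t (1 + 1 / (D₀ : ℝ)) (j + 1)) := by
    rw [Finset.mem_Ioc]; omega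
  have h1 : (l : ℝ) ≤ (1 + 2 * (1 / (D₀ : ℝ))) * ((bp 0 L (1 + 1 / (D₀ : ℝ)) κ + 1 : ℕ) : ℝ) := cell_spread_rel hδ0 hl0 hl
  have h2 : (m : ℝ) ≤ (1 + 2 * (1 / (D₀ : ℝ))) * ((bpM mlo M' t (1 + 1 / (D₀ : ℝ)) i + 1 : ℕ) : ℝ) := by
    unfold bpM at hm0 hm ⊢; exact cell_spread_rel hδ0 hm0 hm
  have h3 : (n : ℝ) ≤ (1 + 2 * (1 / (D₀ : ℝ))) * ((bpN nlo N' t (1 + 1 / (D₀ : ℝ)) j + 1 : ℕ) : ℝ) := by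
    unfold bpN at hn0 hn ⊢; exact cell_spread_rel hδ0 hn0 hn
  set lm : ℕ := bp 0 L (1 + 1 / (D₀ : ℝ)) κ + 1 with hlm
  set mm : ℕ := bpM mlo M' t (1 + 1 / (D₀ : ℝ)) i + 1 with hmm
  set nm : ℕ := bpN nlo N' t (1 + 1 / (D₀ : ℝ)) j + 1 with hnm
  have hl3 : (l : ℝ) ≤ 3 * lm := h1.trans (by
    apply mul_le_mul_of_nonneg_right _ (by positivity); linarith)
  have hm3 : (m : ℝ) ≤ 3 * mm := h2.trans (by
    apply mul_le_mul_of_nonneg_right _ (by positivity); linarith)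
  have hn3 : (n : ℝ) ≤ 3 * nm := h3.trans (by
    apply mul_le_mul_of_nonneg_right _ (by positivity); linarith)
  -- `K₋ = P₋ − a ≥ P₋/2` and `P₋ ≥ lm mm nm`
  have hA : (a : ℤ) ≤ a.natAbs := Int.le_natAbs
  have hPnat : 4 * a.natAbs < lm * t.2.1 * t.2.2 * mm * nm := hP
  have haP : a ≤ ((lm * t.2.1 * t.2.2 * mm * nm : ℕ) : ℤ) := by
    have : ((4 * a.natAbs : ℕ) : ℤ) < ((lm * t.2.1 * t.2.2 * mm * nm : ℕ) : ℤ) := by exact_mod_cast hPnat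
    have h' : (a : ℤ) ≤ |a| := le_abs_self a
    push_cast at this ⊢
    nlinarith [abs_nonneg a]
  have hK : ((KmOf a mlo M' nlo N' L t (1 + 1 / (D₀ : ℝ)) κ i j : ℕ) : ℤ) = ((lm * t.2.1 * t.2.2 * mm * nm : ℕ) : ℤ) - a := by
    unfold KmOf; exact cellK_cast haP
  have hKreal : ((KmOf a mlo M' nlo N' L t (1 + 1 / (D₀ : ℝ)) κ i j : ℕ) : ℝ) = ((lm * t.2.1 * t.2.2 * mm * nm : ℕ) : ℝ) - a := by
    have := congrArg (fun z : ℤ => (z : ℝ)) hK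
    push_cast at this ⊢; linarith
  have hPr : (4 * (a.natAbs : ℝ)) < ((lm * t.2.1 * t.2.2 * mm * nm : ℕ) : ℝ) := by exact_mod_cast hPnat
  have har : (a : ℝ) ≤ (a.natAbs : ℝ) := by
    have := (Int.cast_le (R := ℝ)).2 hA
    rwa [Int.cast_natCast] at this
  have hKge : ((lm : ℝ) * mm * nm) / 2 ≤ ((KmOf a mlo M' nlo N' L t (1 + 1 / (D₀ : ℝ)) κ i j : ℕ) : ℝ) := by
    rw [hKreal]
    have hD1 : (1 : ℝ) ≤ (t.2.1 : ℝ) * t.2.2 := by exact_mod_cast Nat.mul_pos hDm hDn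
    have e : ((lm * t.2.1 * t.2.2 * mm * nm : ℕ) : ℝ) = ((lm : ℝ) * mm * nm) * ((t.2.1 : ℝ) * t.2.2) := by push_cast; ring
    rw [e] at hPr ⊢
    have h0 : (0 : ℝ) ≤ (lm : ℝ) * mm * nm := by positivity
    nlinarith
  have hlmn0 : (0 : ℝ) < (l : ℝ) * m * n := by
    have : 0 < l := by omega
    have : 0 < m := by omega
    have : 0 < n := by omega
    positivity
  have hK0 : (0 : ℝ) < ((KmOf a mlo M' nlo N' L t (1 + 1 / (D₀ : ℝ)) κ i j : ℕ) : ℝ) := by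
    have : (0 : ℝ) < (lm : ℝ) * mm * nm := by
      have : 0 < lm := by rw [hlm]; omega
      have : 0 < mm := by rw [hmm]; omega
      have : 0 < nm := by rw [hnm]; omega
      positivity
    linarith
  rw [div_le_div_iff₀ hK0 hlmn0, one_mul]
  have hprod : (l : ℝ) * m * n ≤ 27 * ((lm : ℝ) * mm * nm) := by
    have h0 : (0 : ℝ) ≤ lm := by positivity
    have h0' : (0 : ℝ) ≤ mm := by positivity
    calc (l : ℝ) * m * n ≤ (3 * lm) * (3 * mm) * (3 * nm) := by
          apply mul_le_mul (mul_le_mul hl3 hm3 (by positivity) (by positivity)) hn3 (by positivity) (by positivity)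
      _ = 27 * ((lm : ℝ) * mm * nm) := by ring
  nlinarith

/-- **The window sum of one nonempty cell** (`windows_le` applied to `winSum`). [folklore] -/
theorem winSum_le {a : ℤ} (ha : a ≠ 0) {mlo M' nlo N' L Q' rlo R g D₀ : ℕ} (hD₀ : 0 < D₀) (hQg : 0 < Q' * g)
    (hc : (D₀ + 2) ^ 4 * (D₀ + 1) ≤ 2 * D₀ ^ 5) {t : ℤ × ℕ × ℕ} (hDm : 0 < t.2.1) (hDn : 0 < t.2.2)
    {k κ i j r l m n : ℕ}
    (hr : r ∈ Ioc (bp rlo R (1 + 1 / (D₀ : ℝ)) k) (bp rlo R (1 + 1 / (D₀ : ℝ)) (k + 1)))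
    (hl : l ∈ Ioc (bp 0 L (1 + 1 / (D₀ : ℝ)) κ) (bp 0 L (1 + 1 / (D₀ : ℝ)) (κ + 1)))
    (hm : m ∈ Ioc (bpM mlo M' t (1 + 1 / (D₀ : ℝ)) i) (bpM mlo M' t (1 + 1 / (D₀ : ℝ)) (i + 1)))
    (hn : n ∈ Ioc (bpN nlo N' t (1 + 1 / (D₀ : ℝ)) j) (bpN nlo N' t (1 + 1 / (D₀ : ℝ)) (j + 1)))
    (hP : 4 * a.natAbs * D₀ < (bp 0 L (1 + 1 / (D₀ : ℝ)) κ + 1) * t.2.1 * t.2.2 *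
      (bpM mlo M' t (1 + 1 / (D₀ : ℝ)) i + 1) * (bpN nlo N' t (1 + 1 / (D₀ : ℝ)) j + 1))
    (hpos : a < (((mlo + 1) * (nlo + 1) : ℕ) : ℤ)) :
    winSum a mlo M' nlo N' L Q' rlo R g t (1 + 1 / (D₀ : ℝ)) k κ i j ≤
      totInvSum (KpOf a mlo M' nlo N' L t (1 + 1 / (D₀ : ℝ)) κ i j) *
        (2 * Real.log ((((D₀ + 2) ^ 4 * (D₀ + 1) : ℕ) : ℝ) / ((D₀ ^ 5 : ℕ) : ℝ)) +
          200 * (((Q' * g * bp rlo R (1 + 1 / (D₀ : ℝ)) (k + 1) : ℕ) : ℝ) / KmOf a mlo M' nlo N' L t (1 + 1 / (D₀ : ℝ)) κ i j)) := by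
  have hsp := spread_of_cells ha hD₀ hr hl hm hn hP
  have hKm1 := one_le_KmOf (M' := M') (N' := N') (L := L) hDm hDn hpos (1 + 1 / (D₀ : ℝ)) κ i j
  have hKmp := KmOf_le_KpOf (a := a) hl hm hn
  have hrc := Finset.mem_Ioc.1 hr
  have hrm : 0 < Q' * g * (bp rlo R (1 + 1 / (D₀ : ℝ)) k + 1) := Nat.mul_pos hQg (by omega)
  have hrmp : Q' * g * (bp rlo R (1 + 1 / (D₀ : ℝ)) k + 1) ≤ Q' * g * bp rlo R (1 + 1 / (D₀ : ℝ)) (k + 1) :=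
    Nat.mul_le_mul_left _ (by omega)
  have hc₁ : 0 < D₀ ^ 5 := pow_pos hD₀ 5
  have hc₁₂ : D₀ ^ 5 ≤ (D₀ + 2) ^ 4 * (D₀ + 1) := by
    calc D₀ ^ 5 = D₀ ^ 4 * D₀ := by ring
      _ ≤ (D₀ + 2) ^ 4 * (D₀ + 1) := Nat.mul_le_mul (Nat.pow_le_pow_left (by omega) 4) (by omega)
  have hspread' : Q' * g * bp rlo R (1 + 1 / (D₀ : ℝ)) (k + 1) * KpOf a mlo M' nlo N' L t (1 + 1 / (D₀ : ℝ)) κ i j * D₀ ^ 5 ≤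
      Q' * g * (bp rlo R (1 + 1 / (D₀ : ℝ)) k + 1) * KmOf a mlo M' nlo N' L t (1 + 1 / (D₀ : ℝ)) κ i j *
        ((D₀ + 2) ^ 4 * (D₀ + 1)) := by
    have := Nat.mul_le_mul_left (Q' * g) hsp
    calc Q' * g * bp rlo R (1 + 1 / (D₀ : ℝ)) (k + 1) * KpOf a mlo M' nlo N' L t (1 + 1 / (D₀ : ℝ)) κ i j * D₀ ^ 5
        = Q' * g * (bp rlo R (1 + 1 / (D₀ : ℝ)) (k + 1) * KpOf a mlo M' nlo N' L t (1 + 1 / (D₀ : ℝ)) κ i j * D₀ ^ 5) := by ring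
      _ ≤ Q' * g * ((bp rlo R (1 + 1 / (D₀ : ℝ)) k + 1) * KmOf a mlo M' nlo N' L t (1 + 1 / (D₀ : ℝ)) κ i j *
          ((D₀ + 2) ^ 4 * (D₀ + 1))) := this
      _ = _ := by ring
  have h := windows_le hKm1 hKmp hrm hrmp hc₁ hc₁₂ hc hspread'
  unfold winSum
  convert h using 2

/-! ### The ambiguous `B`-part summed over one reduction term -/

/-- `4 |a| D₀ < (mlo+1)(nlo+1) ≤ P₋`: the lower corner of every cell of a piece exceeds the threshold.
[folklore] -/
theorem lt_Pminus {a : ℤ} {mlo M' nlo N' L D₀ : ℕ} {t : ℤ × ℕ × ℕ} (hDm : 0 < t.2.1) (hDn : 0 < t.2.2)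
    (hpiece : 4 * a.natAbs * D₀ < (mlo + 1) * (nlo + 1)) (β : ℝ) (κ i j : ℕ) :
    4 * a.natAbs * D₀ < (bp 0 L β κ + 1) * t.2.1 * t.2.2 * (bpM mlo M' t β i + 1) * (bpN nlo N' t β j + 1) := by
  refine lt_of_lt_of_le hpiece ?_
  have hm1 : mlo + 1 ≤ t.2.1 * (bpM mlo M' t β i + 1) := by
    have h1 : mlo / t.2.1 ≤ bpM mlo M' t β i := by unfold bpM; exact (bp_bounds _ _ _ _).1
    have h2 : mlo < t.2.1 * (mlo / t.2.1 + 1) := by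
      have h := Nat.lt_div_mul_add (a := mlo) hDm
      have e : mlo / t.2.1 * t.2.1 + t.2.1 = t.2.1 * (mlo / t.2.1 + 1) := by ring
      rw [e] at h; exact h
    exact (Nat.succ_le_of_lt h2).trans (Nat.mul_le_mul_left _ (by omega))
  have hn1 : nlo + 1 ≤ t.2.2 * (bpN nlo N' t β j + 1) := by
    have h1 : nlo / t.2.2 ≤ bpN nlo N' t β j := by unfold bpN; exact (bp_bounds _ _ _ _).1
    have h2 : nlo < t.2.2 * (nlo / t.2.2 + 1) := by
      have h := Nat.lt_div_mul_add (a := nlo) hDn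
      have e : nlo / t.2.2 * t.2.2 + t.2.2 = t.2.2 * (nlo / t.2.2 + 1) := by ring
      rw [e] at h; exact h
    exact (Nat.succ_le_of_lt h2).trans (Nat.mul_le_mul_left _ (by omega))
  calc (mlo + 1) * (nlo + 1) ≤ (t.2.1 * (bpM mlo M' t β i + 1)) * (t.2.2 * (bpN nlo N' t β j + 1)) :=
        Nat.mul_le_mul hm1 hn1
    _ = 1 * t.2.1 * t.2.2 * (bpM mlo M' t β i + 1) * (bpN nlo N' t β j + 1) := by ring
    _ ≤ (bp 0 L β κ + 1) * t.2.1 * t.2.2 * (bpM mlo M' t β i + 1) * (bpN nlo N' t β j + 1) := by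
        gcongr; omega

/-- `1/φ(P r) ≤ 1/φ(r)` for `P ≥ 1`. [folklore] -/
theorem inv_totient_mul_le_right {P r : ℕ} (hP : 0 < P) (hr : 0 < r) :
    (1 : ℝ) / Nat.totient (P * r) ≤ 1 / Nat.totient r := by
  have h1 : Nat.totient P * Nat.totient r ≤ Nat.totient (P * r) := Nat.totient_super_multiplicative P r
  have h2 : 1 ≤ Nat.totient P := Nat.totient_pos.2 hP
  have h3 : Nat.totient r ≤ Nat.totient (P * r) := le_trans (by nlinarith) h1
  have hφr : (0 : ℝ) < Nat.totient r := by exact_mod_cast Nat.totient_pos.2 hr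
  exact div_le_div_of_nonneg_left zero_le_one hφr (by exact_mod_cast h3)

/-- Sums over the cells of `[lo, X]` are dominated by sums over `[1, X]` (no filter). [folklore] -/
theorem sum_cells_le_sum_Icc {rlo R : ℕ} {β : ℝ} (hβ : 1 ≤ β) {J : ℕ} (hJR : bp rlo R β J = R)
    (h : ℕ → ℝ) (hh : ∀ r, 0 ≤ h r) :
    ∑ k ∈ range J, ∑ r ∈ Ioc (bp rlo R β k) (bp rlo R β (k + 1)), h r ≤ ∑ r ∈ Icc 1 R, h r := by
  classical
  have := sum_cells_filter_le_sum_Icc hβ hJR (fun _ => True) h hh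
  simpa only [Finset.filter_true_of_mem (fun _ _ => trivial)] using this

/-- Factoring a double sum of rank-one terms. [folklore] -/
theorem sum_sum_rank_one (A B : ℝ) (c e s u : ℕ → ℝ) (I : Finset ℕ) (I' : Finset ℕ) :
    ∑ i ∈ I, ∑ j ∈ I', (A * c i * e j + B * s i * u j) =
      A * (∑ i ∈ I, c i) * (∑ j ∈ I', e j) + B * (∑ i ∈ I, s i) * (∑ j ∈ I', u j) := by
  have h1 : ∀ i ∈ I, ∑ j ∈ I', (A * c i * e j + B * s i * u j) = (A * c i) * (∑ j ∈ I', e j) + (B * s i) * (∑ j ∈ I', u j) := by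
    intro i _
    rw [Finset.sum_add_distrib, Finset.mul_sum, Finset.mul_sum]
  rw [Finset.sum_congr rfl h1, Finset.sum_add_distrib, ← Finset.sum_mul, ← Finset.sum_mul, ← Finset.mul_sum, ← Finset.mul_sum]

set_option maxHeartbeats 3200000 in
/-- **The `B`-part of one reduction term.** With `η = log(c₂/c₁)`:
`∑_{k,κ,r,l,i,j} |C_i||C_j| winSum/φ(P r) ≤ Φ(S) (2η C (log Y)^4 · L M' N' + 32400 Q' g C⁴ (R+2)(log Y)^16)`.
[cite: BombieriFriedlanderIwaniecActa1986, §13 p. 241–242] -/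
theorem Bsum_le {C : ℝ} (hC1 : 1 ≤ C)
    (hC : ∀ X Y : ℕ, X ≤ Y → 2 ≤ Y →
      (∑ n ∈ Icc 1 X, (σ 0 n : ℝ)) ≤ C * ((X : ℝ) + 2) * Real.log Y ^ 4 ∧
      (∑ n ∈ Icc 1 X, (σ 0 n : ℝ) / n) ≤ C * Real.log Y ^ 4 ∧
      (∑ n ∈ Icc 1 X, (σ 0 n : ℝ) ^ 2) ≤ C * ((X : ℝ) + 2) * Real.log Y ^ 8 ∧
      (∑ n ∈ Icc 1 X, (σ 0 n : ℝ) ^ 2 / n) ≤ C * Real.log Y ^ 8)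
    {a : ℤ} (ha : a ≠ 0) {mlo M' nlo N' L Q' rlo R S d g D₀ J Y : ℕ} (hD₀ : 0 < D₀)
    (hc : (D₀ + 2) ^ 4 * (D₀ + 1) ≤ 2 * D₀ ^ 5) (hQ' : 0 < Q') (hd : d ∣ a.natAbs)
    (hgΘ : g ∣ ThetaD a.natAbs d) (v : List ℕ) {t : ℤ × ℕ × ℕ} (ht : t ∈ Tsel a d g (profFun a v))
    (hmlo : mlo ≤ M') (hnlo : nlo ≤ N') (hrlo : rlo ≤ R)
    (hpiece : 4 * a.natAbs * D₀ < (mlo + 1) * (nlo + 1))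
    (hJ : ((max (max M' N') (max R L) : ℕ) : ℝ) + 1 ≤ (1 + 1 / (D₀ : ℝ)) ^ J)
    (hS : L * M' * N' + a.natAbs ≤ S) (hY : 2 ≤ Y) (hLY : L ≤ Y) (hMY : M' ≤ Y) (hNY : N' ≤ Y) (hRY : R ≤ Y) :
    ∑ k ∈ range J, ∑ κ ∈ range J,
      ∑ r ∈ (Ioc (bp rlo R (1 + 1 / (D₀ : ℝ)) k) (bp rlo R (1 + 1 / (D₀ : ℝ)) (k + 1))).filter
          (fun r : ℕ => IsCoprime (r : ℤ) a),
        ∑ _l ∈ (Ioc (bp 0 L (1 + 1 / (D₀ : ℝ)) κ) (bp 0 L (1 + 1 / (D₀ : ℝ)) (κ + 1))).filter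
            (fun l : ℕ => l.Coprime r ∧ profVec a l = v),
          ∑ i ∈ range J, ∑ j ∈ range J,
            ((Ioc (bpM mlo M' t (1 + 1 / (D₀ : ℝ)) i) (bpM mlo M' t (1 + 1 / (D₀ : ℝ)) (i + 1))).card : ℝ) *
              (Ioc (bpN nlo N' t (1 + 1 / (D₀ : ℝ)) j) (bpN nlo N' t (1 + 1 / (D₀ : ℝ)) (j + 1))).card *
              winSum a mlo M' nlo N' L Q' rlo R g t (1 + 1 / (D₀ : ℝ)) k κ i j / Nat.totient (Pa a d g * r) ≤
      totInvSum S * (2 * Real.log ((((D₀ + 2) ^ 4 * (D₀ + 1) : ℕ) : ℝ) / ((D₀ ^ 5 : ℕ) : ℝ)) * (C * Real.log Y ^ 4) *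
          ((L : ℝ) * M' * N') +
        32400 * Q' * g * C ^ 4 * ((R : ℝ) + 2) * Real.log Y ^ 16) := by
  classical
  set β : ℝ := 1 + 1 / (D₀ : ℝ) with hβ
  have hβ1 : 1 ≤ β := le_add_of_nonneg_right (by positivity)
  have hδ0 : (0 : ℝ) ≤ 1 / (D₀ : ℝ) := by positivity
  have hδ1 : 1 / (D₀ : ℝ) ≤ 1 := by rw [div_le_one (by exact_mod_cast hD₀)]; exact_mod_cast hD₀
  set η : ℝ := Real.log ((((D₀ + 2) ^ 4 * (D₀ + 1) : ℕ) : ℝ) / ((D₀ ^ 5 : ℕ) : ℝ)) with hη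
  have hη0 : 0 ≤ η := by
    apply Real.log_nonneg
    rw [le_div_iff₀ (by positivity), one_mul]
    have : D₀ ^ 5 ≤ (D₀ + 2) ^ 4 * (D₀ + 1) := by
      calc D₀ ^ 5 = D₀ ^ 4 * D₀ := by ring
        _ ≤ (D₀ + 2) ^ 4 * (D₀ + 1) := Nat.mul_le_mul (Nat.pow_le_pow_left (by omega) 4) (by omega)
    exact_mod_cast this
  obtain ⟨-, hterms, -⟩ := Tsel_spec ha hd hgΘ (profFun a v)
  obtain ⟨-, hDm, hDn, -⟩ := hterms t ht
  have hP0 : 0 < Pa a d g := Pa_pos a d g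
  have hg0 : 0 < g := Nat.pos_of_ne_zero fun h0 => by
    rw [h0, zero_dvd_iff] at hgΘ; exact (ThetaD_pos a.natAbs d).ne' hgΘ
  have hQg : 0 < Q' * g := Nat.mul_pos hQ' hg0
  have hA1 : 1 ≤ a.natAbs := Int.natAbs_pos.2 ha
  have hposmn : a < (((mlo + 1) * (nlo + 1) : ℕ) : ℤ) := by
    have h2 : a.natAbs ≤ 4 * a.natAbs * D₀ := by nlinarith
    have h3 : (a : ℤ) ≤ a.natAbs := Int.le_natAbs
    have h4 : ((a.natAbs : ℕ) : ℤ) < (((mlo + 1) * (nlo + 1) : ℕ) : ℤ) := by exact_mod_cast lt_of_le_of_lt h2 hpiece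
    linarith
  have hlogY : 0 ≤ Real.log Y := Real.log_nonneg (by exact_mod_cast (by omega : 1 ≤ Y))
  have hΦS := totInvSum_nonneg S
  -- tops of the cells
  have hJR : bp rlo R β J = R := by
    apply bp_eq_top hrlo; refine le_trans ?_ hJ
    have : (R : ℝ) ≤ ((max (max M' N') (max R L) : ℕ) : ℝ) := by exact_mod_cast le_max_of_le_right (le_max_left _ _)
    linarith
  have hJL : bp 0 L β J = L := by
    apply bp_eq_top (Nat.zero_le L); refine le_trans ?_ hJ
    have : (L : ℝ) ≤ ((max (max M' N') (max R L) : ℕ) : ℝ) := by exact_mod_cast le_max_of_le_right (le_max_right _ _)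
    linarith
  have hJM : bpM mlo M' t β J = M' / t.2.1 := by
    unfold bpM; apply bp_eq_top (Nat.div_le_div_right hmlo); refine le_trans ?_ hJ
    have h1 : ((M' / t.2.1 : ℕ) : ℝ) ≤ M' := by exact_mod_cast Nat.div_le_self M' t.2.1
    have h2 : (M' : ℝ) ≤ ((max (max M' N') (max R L) : ℕ) : ℝ) := by exact_mod_cast le_max_of_le_left (le_max_left _ _)
    linarith
  have hJN : bpN nlo N' t β J = N' / t.2.2 := by
    unfold bpN; apply bp_eq_top (Nat.div_le_div_right hnlo); refine le_trans ?_ hJ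
    have h1 : ((N' / t.2.2 : ℕ) : ℝ) ≤ N' := by exact_mod_cast Nat.div_le_self N' t.2.2
    have h2 : (N' : ℝ) ≤ ((max (max M' N') (max R L) : ℕ) : ℝ) := by exact_mod_cast le_max_of_le_left (le_max_right _ _)
    linarith
  -- abbreviations for the cells
  set CM : ℕ → Finset ℕ := fun i => Ioc (bpM mlo M' t β i) (bpM mlo M' t β (i + 1)) with hCM
  set CN : ℕ → Finset ℕ := fun j => Ioc (bpN nlo N' t β j) (bpN nlo N' t β (j + 1)) with hCN
  set sM : ℕ → ℝ := fun i => ∑ m ∈ CM i, (1 : ℝ) / m with hsM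
  set sN : ℕ → ℝ := fun j => ∑ n ∈ CN j, (1 : ℝ) / n with hsN
  have hsM0 : ∀ i, 0 ≤ sM i := fun i => Finset.sum_nonneg fun _ _ => by positivity
  have hsN0 : ∀ j, 0 ≤ sN j := fun j => Finset.sum_nonneg fun _ _ => by positivity
  -- Step 1: the pointwise bound
  have hpt : ∀ k, ∀ κ, ∀ r ∈ (Ioc (bp rlo R β k) (bp rlo R β (k + 1))).filter (fun r : ℕ => IsCoprime (r : ℤ) a),
      ∀ l ∈ (Ioc (bp 0 L β κ) (bp 0 L β (κ + 1))).filter (fun l : ℕ => l.Coprime r ∧ profVec a l = v), ∀ i j : ℕ,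
      ((CM i).card : ℝ) * (CN j).card * winSum a mlo M' nlo N' L Q' rlo R g t β k κ i j / Nat.totient (Pa a d g * r) ≤
        ((1 : ℝ) / Nat.totient r * (2 * η * totInvSum S)) * ((CM i).card : ℝ) * (CN j).card +
          ((1 : ℝ) / Nat.totient r * (10800 * totInvSum S * (Q' * g) * (3 * r)) * (1 / (l : ℝ))) * sM i * sN j := by
    intro k κ r hr l hl i j
    have hrc := (Finset.mem_filter.1 hr).1
    have hlc := (Finset.mem_filter.1 hl).1
    have hr0 : 0 < r := by have := Finset.mem_Ioc.1 hrc; omega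
    have hl0 : 0 < l := by have := Finset.mem_Ioc.1 hlc; omega
    have hl0' : (0 : ℝ) < l := by exact_mod_cast hl0
    have hφ := inv_totient_mul_le_right hP0 hr0
    have hφr : (0 : ℝ) < Nat.totient r := by exact_mod_cast Nat.totient_pos.2 hr0
    have hφPr : (0 : ℝ) < Nat.totient (Pa a d g * r) := by exact_mod_cast Nat.totient_pos.2 (Nat.mul_pos hP0 hr0)
    have hW0 := winSum_nonneg a mlo M' nlo N' L Q' rlo R g t β k κ i j
    have hRHS0 : 0 ≤ ((1 : ℝ) / Nat.totient r * (2 * η * totInvSum S)) * ((CM i).card : ℝ) * (CN j).card +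
        ((1 : ℝ) / Nat.totient r * (10800 * totInvSum S * (Q' * g) * (3 * r)) * (1 / (l : ℝ))) * sM i * sN j := by
      have := hsM0 i; have := hsN0 j
      positivity
    by_cases hE : (CM i).card = 0 ∨ (CN j).card = 0
    · have : ((CM i).card : ℝ) * (CN j).card = 0 := by
        rcases hE with h | h <;> simp [h]
      rw [this, zero_mul, zero_div]
      exact hRHS0
    · push Not at hE
      obtain ⟨m, hm⟩ := Finset.card_pos.1 (Nat.pos_of_ne_zero hE.1)
      obtain ⟨n, hn⟩ := Finset.card_pos.1 (Nat.pos_of_ne_zero hE.2)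
      have hPm := lt_Pminus (a := a) (M' := M') (N' := N') (L := L) hDm hDn hpiece β κ i j
      have hW := winSum_le ha hD₀ hQg hc hDm hDn hrc hlc hm hn hPm hposmn
      have hΦKp : totInvSum (KpOf a mlo M' nlo N' L t β κ i j) ≤ totInvSum S :=
        totInvSum_mono ((KpOf_le hmlo hnlo t β κ i j).trans hS)
      -- `rp ≤ 3 r`
      have hrp : (((Q' * g * bp rlo R β (k + 1) : ℕ)) : ℝ) ≤ (Q' * g : ℝ) * (3 * r) := by
        have hrpc : bp rlo R β (k + 1) ∈ Ioc (bp rlo R β k) (bp rlo R β (k + 1)) := by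
          have := Finset.mem_Ioc.1 hrc; rw [Finset.mem_Ioc]; omega
        have h1 : ((bp rlo R β (k + 1) : ℕ) : ℝ) ≤ (1 + 2 * (1 / (D₀ : ℝ))) * r := cell_spread_rel hδ0 hrc hrpc
        have h2 : ((bp rlo R β (k + 1) : ℕ) : ℝ) ≤ 3 * r := h1.trans (by
          apply mul_le_mul_of_nonneg_right _ (by positivity); linarith)
        push_cast
        exact mul_le_mul_of_nonneg_left h2 (by positivity)
      -- `|C_i||C_j| / K₋ ≤ 54 (1/l) sM sN`
      have hK : ((CM i).card : ℝ) * (CN j).card * ((1 : ℝ) / KmOf a mlo M' nlo N' L t β κ i j) ≤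
          54 * (1 / (l : ℝ)) * sM i * sN j := by
        have e : ((CM i).card : ℝ) * (CN j).card * ((1 : ℝ) / KmOf a mlo M' nlo N' L t β κ i j) =
            ∑ _m ∈ CM i, ∑ _n ∈ CN j, (1 : ℝ) / KmOf a mlo M' nlo N' L t β κ i j := by
          rw [Finset.sum_const, Finset.sum_const, nsmul_eq_mul, nsmul_eq_mul]; ring
        have e2 : 54 * (1 / (l : ℝ)) * sM i * sN j =
            ∑ m' ∈ CM i, ∑ n' ∈ CN j, 54 * (1 / (l : ℝ)) * (1 / (m' : ℝ)) * (1 / (n' : ℝ)) := by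
          have : sM i * sN j = ∑ m' ∈ CM i, ∑ n' ∈ CN j, (1 / (m' : ℝ)) * (1 / (n' : ℝ)) := Finset.sum_mul_sum _ _ _ _
          rw [mul_assoc (54 * (1 / (l : ℝ))), this, Finset.mul_sum]
          refine Finset.sum_congr rfl fun m' _ => ?_
          rw [Finset.mul_sum]
          refine Finset.sum_congr rfl fun n' _ => ?_
          ring
        rw [e, e2]
        refine Finset.sum_le_sum fun m' hm' => Finset.sum_le_sum fun n' hn' => ?_
        have hP4 : 4 * a.natAbs < (bp 0 L β κ + 1) * t.2.1 * t.2.2 * (bpM mlo M' t β i + 1) * (bpN nlo N' t β j + 1) :=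
          lt_of_le_of_lt (Nat.le_mul_of_pos_right _ hD₀) hPm
        have h := inv_KmOf_le (a := a) hD₀ hDm hDn hlc hm' hn' hP4
        have hm0 : (0 : ℝ) < m' := by have := Finset.mem_Ioc.1 hm'; exact_mod_cast (by omega : 0 < m')
        have hn0 : (0 : ℝ) < n' := by have := Finset.mem_Ioc.1 hn'; exact_mod_cast (by omega : 0 < n')
        calc (1 : ℝ) / KmOf a mlo M' nlo N' L t β κ i j ≤ 54 / ((l : ℝ) * m' * n') := h
          _ = 54 * (1 / (l : ℝ)) * (1 / (m' : ℝ)) * (1 / (n' : ℝ)) := by field_simp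
      -- combine
      have hKm0 : (0 : ℝ) < KmOf a mlo M' nlo N' L t β κ i j := by
        exact_mod_cast one_le_KmOf (M' := M') (N' := N') (L := L) hDm hDn hposmn β κ i j
      have hcc : 0 ≤ ((CM i).card : ℝ) * (CN j).card := by positivity
      calc ((CM i).card : ℝ) * (CN j).card * winSum a mlo M' nlo N' L Q' rlo R g t β k κ i j / Nat.totient (Pa a d g * r)
          = (1 / Nat.totient (Pa a d g * r)) * (((CM i).card : ℝ) * (CN j).card * winSum a mlo M' nlo N' L Q' rlo R g t β k κ i j) := by
            ring
        _ ≤ ((1 : ℝ) / Nat.totient r) * (((CM i).card : ℝ) * (CN j).card *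
            (totInvSum S * (2 * η + 200 * ((Q' * g : ℝ) * (3 * r) * (1 / KmOf a mlo M' nlo N' L t β κ i j))))) := by
            apply mul_le_mul hφ _ (by positivity) (by positivity)
            apply mul_le_mul_of_nonneg_left _ hcc
            refine hW.trans ?_
            apply mul_le_mul hΦKp _ (by positivity) hΦS
            have : (((Q' * g * bp rlo R β (k + 1) : ℕ)) : ℝ) / KmOf a mlo M' nlo N' L t β κ i j ≤
                (Q' * g : ℝ) * (3 * r) * (1 / KmOf a mlo M' nlo N' L t β κ i j) := by
              rw [mul_one_div]
              exact div_le_div_of_nonneg_right hrp hKm0.le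
            linarith
        _ = ((1 : ℝ) / Nat.totient r * (2 * η * totInvSum S)) * ((CM i).card : ℝ) * (CN j).card +
            ((1 : ℝ) / Nat.totient r * (200 * totInvSum S * (Q' * g) * (3 * r))) *
              (((CM i).card : ℝ) * (CN j).card * (1 / KmOf a mlo M' nlo N' L t β κ i j)) := by ring
        _ ≤ ((1 : ℝ) / Nat.totient r * (2 * η * totInvSum S)) * ((CM i).card : ℝ) * (CN j).card +
            ((1 : ℝ) / Nat.totient r * (200 * totInvSum S * (Q' * g) * (3 * r))) * (54 * (1 / (l : ℝ)) * sM i * sN j) := by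
            apply add_le_add le_rfl
            exact mul_le_mul_of_nonneg_left hK (by positivity)
        _ = _ := by ring
  -- Step 2: the one-variable sums
  have hcardM : ∑ i ∈ range J, ((CM i).card : ℝ) ≤ M' := by
    have h := sum_cells_le_sum_Icc (rlo := mlo / t.2.1) (R := M' / t.2.1) hβ1 (by unfold bpM at hJM; exact hJM)
      (fun _ => (1 : ℝ)) (fun _ => zero_le_one)
    simp only [Finset.sum_const, nsmul_eq_mul, mul_one, Nat.card_Icc, add_tsub_cancel_right] at h
    exact h.trans (by exact_mod_cast Nat.div_le_self M' t.2.1)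
  have hcardN : ∑ j ∈ range J, ((CN j).card : ℝ) ≤ N' := by
    have h := sum_cells_le_sum_Icc (rlo := nlo / t.2.2) (R := N' / t.2.2) hβ1 (by unfold bpN at hJN; exact hJN)
      (fun _ => (1 : ℝ)) (fun _ => zero_le_one)
    simp only [Finset.sum_const, nsmul_eq_mul, mul_one, Nat.card_Icc, add_tsub_cancel_right] at h
    exact h.trans (by exact_mod_cast Nat.div_le_self N' t.2.2)
  obtain ⟨-, hMd, -, -⟩ := hC M' Y hMY hY
  obtain ⟨-, hNd, -, -⟩ := hC N' Y hNY hY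
  obtain ⟨-, hLd, -, -⟩ := hC L Y hLY hY
  obtain ⟨hRs, hRd, -, -⟩ := hC R Y hRY hY
  have hinv_le_sig : ∀ X : ℕ, ∑ m ∈ Icc 1 X, (1 : ℝ) / m ≤ ∑ m ∈ Icc 1 X, (σ 0 m : ℝ) / m := by
    intro X
    refine Finset.sum_le_sum fun m hm => ?_
    have hm1 : 1 ≤ m := (Finset.mem_Icc.1 hm).1
    apply div_le_div_of_nonneg_right _ (by positivity)
    have : 1 ≤ σ 0 m := by
      rw [ArithmeticFunction.sigma_zero_apply]; exact Finset.card_pos.2 ⟨1, Nat.one_mem_divisors.2 (by omega)⟩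
    exact_mod_cast this
  have hinvM : ∑ i ∈ range J, sM i ≤ C * Real.log Y ^ 4 := by
    have h := sum_cells_le_sum_Icc (rlo := mlo / t.2.1) (R := M' / t.2.1) hβ1 (by unfold bpM at hJM; exact hJM)
      (fun m => (1 : ℝ) / m) (fun _ => by positivity)
    refine h.trans ((hinv_le_sig _).trans ((Finset.sum_le_sum_of_subset_of_nonneg (fun m hm => ?_)
      fun _ _ _ => by positivity).trans hMd))
    rw [Finset.mem_Icc] at hm ⊢; exact ⟨hm.1, hm.2.trans (Nat.div_le_self _ _)⟩
  have hinvN : ∑ j ∈ range J, sN j ≤ C * Real.log Y ^ 4 := by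
    have h := sum_cells_le_sum_Icc (rlo := nlo / t.2.2) (R := N' / t.2.2) hβ1 (by unfold bpN at hJN; exact hJN)
      (fun n => (1 : ℝ) / n) (fun _ => by positivity)
    refine h.trans ((hinv_le_sig _).trans ((Finset.sum_le_sum_of_subset_of_nonneg (fun n hn => ?_)
      fun _ _ _ => by positivity).trans hNd))
    rw [Finset.mem_Icc] at hn ⊢; exact ⟨hn.1, hn.2.trans (Nat.div_le_self _ _)⟩
  have h0M : 0 ≤ ∑ i ∈ range J, ((CM i).card : ℝ) := Finset.sum_nonneg fun _ _ => by positivity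
  have h0N : 0 ≤ ∑ j ∈ range J, ((CN j).card : ℝ) := Finset.sum_nonneg fun _ _ => by positivity
  have h0m : 0 ≤ ∑ i ∈ range J, sM i := Finset.sum_nonneg fun i _ => hsM0 i
  have h0n : 0 ≤ ∑ j ∈ range J, sN j := Finset.sum_nonneg fun j _ => hsN0 j
  -- Step 3: sum over `i, j`, then `κ, l`
  have hij : ∀ k, ∀ κ, ∀ r ∈ (Ioc (bp rlo R β k) (bp rlo R β (k + 1))).filter (fun r : ℕ => IsCoprime (r : ℤ) a),
      ∀ l ∈ (Ioc (bp 0 L β κ) (bp 0 L β (κ + 1))).filter (fun l : ℕ => l.Coprime r ∧ profVec a l = v),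
      ∑ i ∈ range J, ∑ j ∈ range J,
        ((CM i).card : ℝ) * (CN j).card * winSum a mlo M' nlo N' L Q' rlo R g t β k κ i j / Nat.totient (Pa a d g * r) ≤
        ((1 : ℝ) / Nat.totient r) * (2 * η * totInvSum S * ((M' : ℝ) * N')) * 1 +
          ((r : ℝ) / Nat.totient r) * (32400 * totInvSum S * (Q' * g) * (C * Real.log Y ^ 4) * (C * Real.log Y ^ 4)) * (1 / (l : ℝ)) := by
    intro k κ r hr l hl
    have hl0 : (0 : ℝ) < l := by
      have := Finset.mem_Ioc.1 (Finset.mem_filter.1 hl).1; exact_mod_cast (by omega : 0 < l)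
    have hr0 : (0 : ℝ) < Nat.totient r := by
      have := Finset.mem_Ioc.1 (Finset.mem_filter.1 hr).1
      exact_mod_cast Nat.totient_pos.2 (by omega : 0 < r)
    calc ∑ i ∈ range J, ∑ j ∈ range J,
          ((CM i).card : ℝ) * (CN j).card * winSum a mlo M' nlo N' L Q' rlo R g t β k κ i j / Nat.totient (Pa a d g * r)
        ≤ ∑ i ∈ range J, ∑ j ∈ range J,
            (((1 : ℝ) / Nat.totient r * (2 * η * totInvSum S)) * ((CM i).card : ℝ) * (CN j).card +
              ((1 : ℝ) / Nat.totient r * (10800 * totInvSum S * (Q' * g) * (3 * r)) * (1 / (l : ℝ))) * sM i * sN j) :=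
          Finset.sum_le_sum fun i _ => Finset.sum_le_sum fun j _ => hpt k κ r hr l hl i j
      _ = ((1 : ℝ) / Nat.totient r * (2 * η * totInvSum S)) * (∑ i ∈ range J, ((CM i).card : ℝ)) *
            (∑ j ∈ range J, ((CN j).card : ℝ)) +
          ((1 : ℝ) / Nat.totient r * (10800 * totInvSum S * (Q' * g) * (3 * r)) * (1 / (l : ℝ))) *
            (∑ i ∈ range J, sM i) * (∑ j ∈ range J, sN j) := sum_sum_rank_one _ _ _ _ _ _ _ _
      _ ≤ ((1 : ℝ) / Nat.totient r * (2 * η * totInvSum S)) * M' * N' +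
          ((1 : ℝ) / Nat.totient r * (10800 * totInvSum S * (Q' * g) * (3 * r)) * (1 / (l : ℝ))) *
            (C * Real.log Y ^ 4) * (C * Real.log Y ^ 4) := by
          have hprod1 := mul_le_mul hcardM hcardN h0N (by positivity : (0 : ℝ) ≤ M')
          have hprod2 := mul_le_mul hinvM hinvN h0n (by positivity : (0 : ℝ) ≤ C * Real.log Y ^ 4)
          apply add_le_add
          · calc ((1 : ℝ) / Nat.totient r * (2 * η * totInvSum S)) * (∑ i ∈ range J, ((CM i).card : ℝ)) *
                  (∑ j ∈ range J, ((CN j).card : ℝ))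
                = ((1 : ℝ) / Nat.totient r * (2 * η * totInvSum S)) * ((∑ i ∈ range J, ((CM i).card : ℝ)) *
                  (∑ j ∈ range J, ((CN j).card : ℝ))) := by ring
              _ ≤ ((1 : ℝ) / Nat.totient r * (2 * η * totInvSum S)) * ((M' : ℝ) * N') :=
                  mul_le_mul_of_nonneg_left hprod1 (by positivity)
              _ = _ := by ring
          · calc ((1 : ℝ) / Nat.totient r * (10800 * totInvSum S * (Q' * g) * (3 * r)) * (1 / (l : ℝ))) *
                  (∑ i ∈ range J, sM i) * (∑ j ∈ range J, sN j)
                = ((1 : ℝ) / Nat.totient r * (10800 * totInvSum S * (Q' * g) * (3 * r)) * (1 / (l : ℝ))) *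
                  ((∑ i ∈ range J, sM i) * (∑ j ∈ range J, sN j)) := by ring
              _ ≤ ((1 : ℝ) / Nat.totient r * (10800 * totInvSum S * (Q' * g) * (3 * r)) * (1 / (l : ℝ))) *
                  ((C * Real.log Y ^ 4) * (C * Real.log Y ^ 4)) :=
                  mul_le_mul_of_nonneg_left hprod2 (by positivity)
              _ = _ := by ring
      _ = _ := by ring
  have hκl : ∀ k, ∀ r ∈ (Ioc (bp rlo R β k) (bp rlo R β (k + 1))).filter (fun r : ℕ => IsCoprime (r : ℤ) a),
      ∑ κ ∈ range J, ∑ l ∈ (Ioc (bp 0 L β κ) (bp 0 L β (κ + 1))).filter (fun l : ℕ => l.Coprime r ∧ profVec a l = v),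
        ∑ i ∈ range J, ∑ j ∈ range J,
          ((CM i).card : ℝ) * (CN j).card * winSum a mlo M' nlo N' L Q' rlo R g t β k κ i j / Nat.totient (Pa a d g * r) ≤
        ((1 : ℝ) / Nat.totient r) * (2 * η * totInvSum S * ((M' : ℝ) * N') * L) +
          ((r : ℝ) / Nat.totient r) * (32400 * totInvSum S * (Q' * g) * (C * Real.log Y ^ 4) * (C * Real.log Y ^ 4) *
            (C * Real.log Y ^ 4)) := by
    intro k r hr
    have hr0 : (0 : ℝ) < Nat.totient r := by
      have := Finset.mem_Ioc.1 (Finset.mem_filter.1 hr).1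
      exact_mod_cast Nat.totient_pos.2 (by omega : 0 < r)
    calc ∑ κ ∈ range J, ∑ l ∈ (Ioc (bp 0 L β κ) (bp 0 L β (κ + 1))).filter (fun l : ℕ => l.Coprime r ∧ profVec a l = v),
          ∑ i ∈ range J, ∑ j ∈ range J,
            ((CM i).card : ℝ) * (CN j).card * winSum a mlo M' nlo N' L Q' rlo R g t β k κ i j / Nat.totient (Pa a d g * r)
        ≤ ∑ κ ∈ range J, ∑ l ∈ (Ioc (bp 0 L β κ) (bp 0 L β (κ + 1))).filter (fun l : ℕ => l.Coprime r ∧ profVec a l = v),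
            (((1 : ℝ) / Nat.totient r) * (2 * η * totInvSum S * ((M' : ℝ) * N')) * 1 +
              ((r : ℝ) / Nat.totient r) * (32400 * totInvSum S * (Q' * g) * (C * Real.log Y ^ 4) * (C * Real.log Y ^ 4)) *
                (1 / (l : ℝ))) :=
          Finset.sum_le_sum fun κ _ => Finset.sum_le_sum fun l hl => hij k κ r hr l hl
      _ ≤ ∑ l ∈ Icc 1 L, (((1 : ℝ) / Nat.totient r) * (2 * η * totInvSum S * ((M' : ℝ) * N')) * 1 +
              ((r : ℝ) / Nat.totient r) * (32400 * totInvSum S * (Q' * g) * (C * Real.log Y ^ 4) * (C * Real.log Y ^ 4)) *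
                (1 / (l : ℝ))) :=
          sum_cells_filter_le_sum_Icc hβ1 hJL _ _ fun l => by positivity
      _ = ((1 : ℝ) / Nat.totient r) * (2 * η * totInvSum S * ((M' : ℝ) * N')) * (∑ _l ∈ Icc 1 L, (1 : ℝ)) +
            ((r : ℝ) / Nat.totient r) * (32400 * totInvSum S * (Q' * g) * (C * Real.log Y ^ 4) * (C * Real.log Y ^ 4)) *
              (∑ l ∈ Icc 1 L, 1 / (l : ℝ)) := by
          rw [Finset.sum_add_distrib, ← Finset.mul_sum, ← Finset.mul_sum]
      _ ≤ ((1 : ℝ) / Nat.totient r) * (2 * η * totInvSum S * ((M' : ℝ) * N')) * L +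
            ((r : ℝ) / Nat.totient r) * (32400 * totInvSum S * (Q' * g) * (C * Real.log Y ^ 4) * (C * Real.log Y ^ 4)) *
              (C * Real.log Y ^ 4) := by
          apply add_le_add
          · apply mul_le_mul_of_nonneg_left _ (by positivity)
            simp
          · exact mul_le_mul_of_nonneg_left ((hinv_le_sig L).trans hLd) (by positivity)
      _ = _ := by ring
  -- Step 4: sum over `k, r`
  calc ∑ k ∈ range J, ∑ κ ∈ range J,
        ∑ r ∈ (Ioc (bp rlo R β k) (bp rlo R β (k + 1))).filter (fun r : ℕ => IsCoprime (r : ℤ) a),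
          ∑ l ∈ (Ioc (bp 0 L β κ) (bp 0 L β (κ + 1))).filter (fun l : ℕ => l.Coprime r ∧ profVec a l = v),
            ∑ i ∈ range J, ∑ j ∈ range J,
              ((CM i).card : ℝ) * (CN j).card * winSum a mlo M' nlo N' L Q' rlo R g t β k κ i j / Nat.totient (Pa a d g * r)
      = ∑ k ∈ range J, ∑ r ∈ (Ioc (bp rlo R β k) (bp rlo R β (k + 1))).filter (fun r : ℕ => IsCoprime (r : ℤ) a),
          ∑ κ ∈ range J, ∑ l ∈ (Ioc (bp 0 L β κ) (bp 0 L β (κ + 1))).filter (fun l : ℕ => l.Coprime r ∧ profVec a l = v),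
            ∑ i ∈ range J, ∑ j ∈ range J,
              ((CM i).card : ℝ) * (CN j).card * winSum a mlo M' nlo N' L Q' rlo R g t β k κ i j / Nat.totient (Pa a d g * r) := by
        refine Finset.sum_congr rfl fun k _ => ?_
        rw [Finset.sum_comm]
    _ ≤ ∑ k ∈ range J, ∑ r ∈ (Ioc (bp rlo R β k) (bp rlo R β (k + 1))).filter (fun r : ℕ => IsCoprime (r : ℤ) a),
          (((1 : ℝ) / Nat.totient r) * (2 * η * totInvSum S * ((M' : ℝ) * N') * L) +
            ((r : ℝ) / Nat.totient r) * (32400 * totInvSum S * (Q' * g) * (C * Real.log Y ^ 4) * (C * Real.log Y ^ 4) *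
              (C * Real.log Y ^ 4))) :=
        Finset.sum_le_sum fun k _ => Finset.sum_le_sum fun r hr => hκl k r hr
    _ ≤ ∑ r ∈ Icc 1 R, (((1 : ℝ) / Nat.totient r) * (2 * η * totInvSum S * ((M' : ℝ) * N') * L) +
            ((r : ℝ) / Nat.totient r) * (32400 * totInvSum S * (Q' * g) * (C * Real.log Y ^ 4) * (C * Real.log Y ^ 4) *
              (C * Real.log Y ^ 4))) :=
        sum_cells_filter_le_sum_Icc hβ1 hJR _ _ fun r => by positivity
    _ = (∑ r ∈ Icc 1 R, (1 : ℝ) / Nat.totient r) * (2 * η * totInvSum S * ((M' : ℝ) * N') * L) +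
        (∑ r ∈ Icc 1 R, (r : ℝ) / Nat.totient r) *
          (32400 * totInvSum S * (Q' * g) * (C * Real.log Y ^ 4) * (C * Real.log Y ^ 4) * (C * Real.log Y ^ 4)) := by
        rw [Finset.sum_add_distrib, Finset.sum_mul, Finset.sum_mul]
    _ ≤ (C * Real.log Y ^ 4) * (2 * η * totInvSum S * ((M' : ℝ) * N') * L) +
        (C * ((R : ℝ) + 2) * Real.log Y ^ 4) *
          (32400 * totInvSum S * (Q' * g) * (C * Real.log Y ^ 4) * (C * Real.log Y ^ 4) * (C * Real.log Y ^ 4)) := by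
        apply add_le_add
        · apply mul_le_mul_of_nonneg_right _ (by positivity)
          exact (Finset.sum_le_sum fun r hr => (div_totient_le_sigma r (Finset.mem_Icc.1 hr).1).2).trans hRd
        · apply mul_le_mul_of_nonneg_right _ (by positivity)
          exact (Finset.sum_le_sum fun r hr => (div_totient_le_sigma r (Finset.mem_Icc.1 hr).1).1).trans hRs
    _ = _ := by ring

end BFI

end Literature.NumberTheory.Sieve
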